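import Summits.BirchSwinnertonDyer.BirchSwinnertonDyer.Theorems.EisensteinPrimesBSDpOnCellCOfNamedFactsV17P
import Summits.BirchSwinnertonDyer.BirchSwinnertonDyer.Theorems.EisensteinPrimesBSDpOnCellCTelescopeCarrierSplit
import Summits.BirchSwinnertonDyer.BirchSwinnertonDyer.Theorems.EisensteinPrimesBSDpOnCellCTelescopeCarrierAlgOfWitness
import Summits.BirchSwinnertonDyer.BirchSwinnertonDyer.Theorems.SignedBaseChangeAnticyclotomicEisensteinDivisibilitySpecializationHerbrand
import Summits.BirchSwinnertonDyer.Rank1Residual.X11b.BDPRouteOpenInputDegenerateFrame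
import Literature.NumberTheory.EllipticCurves.IwasawaAlgebraRankOneIdealProofs
import Literature.NumberTheory.EllipticCurves.IwasawaSelmerIsTorsionProofs
import Literature.NumberTheory.IwasawaTheory.IwasawaAlgebraTwoVarRegularProofs
import HarnessLib

/-!
# Sub-skeleton «K2-module» UNDER the research stub `stub_carrierDivInt` (K2-D♭) of line «telescope» (v6 announced 16:21Z, `stub_carrierAlgW` ↦ `stub_carrierDivInt`; v4 645c0fbc… of record) for crux 4 `BSDpOnCellC` (item stmt-BirchSwinnertonDyer-19034) — ideator bsd-idea-12 g32, crux idea «k2-classical» rev 1.7 (v1.1)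

UNREGISTERED WORKFILE (W-79: publish-only; the skeleton of record `Lines/telescope.lean`, its stubs, and the LEAD's v5/v6
candidates are untouched; the LEAD cruxlead-19034 decides whether anything here is folded). Nothing in this file proves the
crux, a registered stub unconditionally, or any summit statement; BSD is proved for no curve. `lean check`: sorries ONLY in
the two research stubs `stub_branchFibreDiv` (K2-M♭, v1.1) and `stub_branchFibreControl` (K2-M).

## v1.1 (same session): the ROBUST node K2-M♭ and the purity step isolated

§S1 `stub_branchFibreDiv` (K2-M♭) = K2-M with (ctrl₀) + (pure) replaced by the weight-2 divisibility (div₀)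
`p^j·φ₀(char_B X₂) ⊆ Ch_Λ(X_ac(E/K))`; §K1 `carrierDivInt_of_moduleDiv : K2-M♭ → hHer1 → K2-D♭` (sorry-free; `hHer1` = the ONE-SIDED
Herbrand inequality = the REGISTERED `stub_herbrandTranslate` text of line «telescope» v4 verbatim, i.e. x2-p2 #3
`TelescopeHerbrandTranslate.stub_herbrandTranslate` by name); §K2 `moduleDiv_of_module : K2-M → hHer2 → K2-M♭` (sorry-free; the ONLY use of
purity). Reading: K2-D♭ ⇐ K2-M♭ ⇐ K2-M, both arrows proved. Reason (card rev 1.7, F8 = the slack audit F5 carried out): when `X₂` carries a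
Herbrand-matched pseudo-null piece on `V(X)` (the split-multiplicative exceptional zero can put `B/(X,T)` there), (pure) is FALSE while (div₀)
and K2-D♭ remain TRUE — so K2-M♭ is the node a classical proof reaches in both scenarios and K2-M is its «no pseudo-null» refinement.
Stub census v1.1: TWO research stubs (K2-M♭ robust; K2-M stronger), each with a sorry-free kernel to K2-D♭; nothing else sorried.

## What this file shows (kernel-checked): the MODULE-LEVEL statement behind K2-D♭

K2-D♭ (`K2Int.stub_carrierDivInt`, `Lines/telescopeK2int.lean` a94fce70a943; = telescope v6's `stub_carrierDivInt`) asks for a bare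
two-variable series `F₀ ∈ ℤ_p⟦X⟧⟦T⟧` with three divisibility properties. Classically `F₀` is the characteristic series of ONE module:
the `𝔭̄`-strict big dual Selmer group `X₂ := X_ac(𝔸₂/K_∞)` of the Hida branch `ρ₂ : G_K → GL₂(ℤ_p⟦X⟧)` through `f_E`, a finitely
generated torsion module over `B := ℤ_p⟦X⟧⟦T⟧` (inner `X` = weight, outer `T` = anticyclotomic; `A := ℤ_p⟦T⟧ = Λ_ac ⊂ B` via
`PowerSeries.map C`). This file TYPES that module-level statement over the tree's own objects — `X₂ := XBig κ ρ₂ 𝔭bar ∅`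
(`Literature/…/BigGaloisRepSelmer.lean`: the Pontryagin dual of `Sel_{𝔭̄-str}(K, 𝔸₂ ⊗ Λ_ac^∨(Ψ⁻¹))`, a `B`-module for ANY continuous
`ρ₂` with coefficients `ℤ_p⟦X⟧` on a discrete `A₂`) — as ONE stub `stub_branchFibreControl` (K2-M), and proves the SORRY-FREE kernel

  `carrierDivInt_of_module : K2-M → (two-sided Herbrand formula) → K2-D♭` (K2-D♭ = the v6 stub text VERBATIM).

K2-M (same road-R-β prefix and analytic-package hypothesis as K2-D♭, TOKEN FOR TOKEN; conclusion): there exist a discrete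
`ℤ_p⟦X⟧[G_K]`-module `A₂`, `ρ₂`, and a compatible `Λ_ac`-structure on `X₂ := XBig κ ρ₂ 𝔭bar ∅` with
* (fg)     `X₂` finitely generated over `B`;
* (reg₀)   some `s ∉ (X)` kills `X₂`                                   — no `(X)`-primary component (weight-2 fibre is `Λ_ac`-torsion);
* (ctrl₀)  `p^j · char_A(X₂/X·X₂) ⊆ Ch_Λ(X_ac(E/K))`                    — Greenberg–Ochiai control at weight 2, up to a `p`-power;
* (pure)   `(p^m) ⊆ char_A(X₂[X])`                                     — the `X`-torsion of `X₂` is `Λ_ac`-pseudo-`p`-power (purity / no pseudo-null);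
* (reg_k)  for every member `k`, some `s ∉ (X − x_k)` kills `X₂`        — the member fibre is `Λ_ac`-torsion;
* (ctrl_k) `p^j · Ch(X(g_k))·𝓞_{ℂ_p}⟦T⟧ ⊆ char_A(X₂/(X − x_k)X₂)·𝓞_{ℂ_p}⟦T⟧` — one-sided member control, up to a `p`-power.

THE KERNEL (pure commutative algebra over the two retractions `φ₀ = (X ↦ 0) = PowerSeries.map constantCoeff` and
`φ_k = (X ↦ x_k) = PowerSeries.map (evAt x_k)` of `A → B`, both with principal kernel): `F₀ :=` a generator of `char_B(X₂)` with
`φ₀ F₀ ≠ 0` (§C, from (reg₀)); (nondeg) `X ∤ F₀` is `φ₀ F₀ ≠ 0`; (alg∞) is the TWO-SIDED Herbrand formula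
`char_A(X₂/X·X₂) = char_A(X₂[X]) · (F₀(0,T))` (hypothesis `hHer2` = x2-p2 g18's `RetractionSpecialization.charIdeal_quotSMulTop_eq_mul_of_retraction`,
p729686, stated here at universe 0 and fed BY NAME once its olean is on the farm) combined with (pure) and (ctrl₀):
`p^{j+m}·F₀(0,T) ∈ Ch_Λ(X_ac)`, read in `𝓞_{ℂ_p}⟦T⟧`; per member, `Φ₀ := F₀(x_k,T) = φ_k F₀ ≠ 0` because the generator at `π_k` has
`φ_k ≠ 0` (reg_k) and generators are associated, `Φ₀ ≡ F₀ (mod X − x_k)` by the kernel property of `φ_k` (LEAD's landed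
`TelescopeCarrierAlgOfWitness.C_dvd_of_evAtMap_eq_zero`, p729576, instance `𝒪 = ℤ_p`), and the ONE-SIDED Herbrand
`char_A(X₂/π_k X₂) ⊆ (Φ₀)` (the `Ideal.mul_le_left` half of `hHer2`) chained under (ctrl_k).

WHAT IT MEANS. K2-D♭'s three divisibilities are not independent inputs: they are (control) + (purity at weight 2) + (torsion
fibres) for a single big Selmer dual, glued by Herbrand's formula along two different retractions of `ℤ_p⟦X⟧⟦T⟧ → ℤ_p⟦T⟧`. The
research content of crux 4's residual therefore splits CLASSICALLY as (card «k2-classical» rev 1.6, C1♭–C6♭):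
C1♭ the branch `ρ₂` and its `ℤ_p`-integral disc chart with members at `X = x_k` (Hida 1986, Greenberg–Stevens 1993 §2) + (fg)
(Greenberg 2006 Prop. 3.2-type finite generation); C2♭/C3♭ = (ctrl₀)/(ctrl_k) Greenberg–Ochiai control with FINITE local defect at
`𝔭̄` (Ochiai 2006 Prop. 5.1-shape — on Cell C the residual representation is REDUCIBLE, so the printed control theorems do not
apply verbatim: this is where the crux is research); C4♭ = (pure): `X₂` has no non-zero pseudo-null `B`-submodule (Greenberg 2016
Prop. 4.1.1-shape: SUR + LEO + no finite-torsion) — then `X₂[X]` is pseudo-null, hence `char_A(X₂[X])` is a `p`-power; C5♭/C6♭ =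
(reg₀)/(reg_k): fibre torsion = `X_ac(E/K)` is `Λ`-torsion (BDP/CGLS on Cell C) and `L_p(g_k) ≠ 0` for the members.

DEGENERATE-WITNESS AUDIT. `A₂ = 0` gives `X₂ = 0`, `F₀ = 1`: then (ctrl₀) demands `p^j ∈ Ch_Λ(X_ac(E/K))`, i.e. K2-M degenerates
exactly as K2-D♭ does (`F₀ := 1` needs `p^j ∈ Ch_Λ(X_ac)·𝓞⟦T⟧`): both are trivially true precisely when the divisibility they serve
(`f_ac ∣ p^j·(BDP L-function)`) is itself trivial (`f_ac` a `p`-power). No junk values: under (reg₀)/(reg_k) the fibres and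
`X₂[π]` are `A`-torsion (killed by `φ s ≠ 0`), so every `Module.charIdeal` in K2-M is a genuine characteristic ideal; `XAc.charIdeal`
and the members' `XBig.charIdeal` carry the same conventions as in K2-D♭ / the registered texts.

Stub census of this sub-skeleton: ONE stub `stub_branchFibreControl` [CONTENT, research — the module-level residual; classical
decomposition C1♭–C6♭ in `Cruxes/BSDpOnCellC/Ideas/k2-classical.md` rev 1.6]. Kernel hypothesis `hHer2` [LANDED-PENDING algebra:
p729686 `…RetractionSpecializationHerbrand.charIdeal_quotSMulTop_eq_mul_of_retraction`, by name:
`fun A B _ _ _ _ _ _ _ _ _ π φ hφ hφπ hker hπ0 N _ _ _ _ _ hs => RetractionSpecialization.charIdeal_quotSMulTop_eq_mul_of_retraction hφ hφπ hker hπ0 N hs`].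
§C = local verbatim copies of six lemmas of x2-p2 g18's ACCEPTED `…RetractionSpecializationCyclic.lean` (p729512; the check farm had not
built its olean at write time) — a fold replaces §C by the import and the tree names.
Sources: Hida, Invent. Math. 85 (1986); Greenberg–Stevens, Invent. Math. 111 (1993) §2; Greenberg, *Iwasawa theory, projective modules,
and modular representations* (2006/2010) Prop. 3.2; Ochiai, Compos. Math. 142 (2006) §§5–7; Delbourgo, LMS LN 356 (2008) Ch. 7, 10;
Greenberg, *On the structure of Selmer groups* (2016) Prop. 4.1.1; Skinner–Urban, Invent. Math. 195 (2014) §3.1.6 / Cor. 3.2.9;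
Castella, Math. Ann. (2018) erratum §2. [cite: GreenbergStevens1993, §2] [cite: Ochiai2006, Prop. 5.1, Lemma 7.2]
[cite: Delbourgo2008, Thm. 7.15, Lemma 10.5] [cite: Greenberg2016, Prop. 4.1.1] [cite: SkinnerUrban2014, Cor. 3.2.9]
[cite: Castella2018Erratum, §2 (2.5)] [cite: BourbakiAC5to7, VII §4.5 Prop. 10]
-/

set_option autoImplicit false
set_option linter.dupNamespace false

noncomputable section

open scoped Classical MatrixGroups ModularForm

open CongruenceSubgroup WeierstrassCurve NumberField IsDedekindDomain Field PowerSeries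
  Literature.NumberTheory.EllipticCurves Literature.NumberTheory.EllipticCurves.GreenbergSelmer
  Literature.NumberTheory.EllipticCurves.ModularForms Literature.NumberTheory.QuadraticFields
  Literature.NumberTheory.EllipticCurves.Rank1Residual
  Literature.NumberTheory.EllipticCurves.Rank1Residual.Typed
  Literature.NumberTheory.EllipticCurves.KrizLi2019
  Literature.NumberTheory.EllipticCurves.GreenbergVatsal2000
  Literature.NumberTheory.EllipticCurves.Wuthrich2014
  Literature.NumberTheory.EllipticCurves.SteinWuthrich2013
  Literature.NumberTheory.EllipticCurves.Castella2018Exceptional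
  Literature.NumberTheory.GaloisRepresentations Literature.NumberTheory.GaloisCohomology
  Literature.NumberTheory.Automorphic
  Summit.BirchSwinnertonDyer.Rank1Residual.X11b.AcSelmer
  Summit.BirchSwinnertonDyer.Rank1Residual.X11b.Halves
  Summit.BirchSwinnertonDyer.Rank1Residual.X11b
  Summit.BirchSwinnertonDyer.Rank1Residual Summit.BirchSwinnertonDyer.Rank1Residual.X1
  Summit.BirchSwinnertonDyer.Rank1Residual.X2
open Literature.NumberTheory.EllipticCurves.KellerYin2024 (curveLocalLambda)

open Literature.NumberTheory.EllipticCurves.BigGaloisRep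

namespace Summit.BirchSwinnertonDyer.BirchSwinnertonDyer.Cruxes.BSDpOnCellC.Telescope.K2Mod

open Literature.NumberTheory.EllipticCurves.CastellaGrossiLeeSkinner2022 Literature.NumberTheory.EllipticCurves.Castella2018
  Literature.NumberTheory.IwasawaTheory Literature.NumberTheory.IwasawaTheory.Greenberg2016
  Literature.NumberTheory.IwasawaTheory.Greenberg2006
  Summit.BirchSwinnertonDyer.Rank1Residual.X1.KellerYinMuLambdaSplit
open Literature.NumberTheory.EllipticCurves.KellerYin2024
open Summit.BirchSwinnertonDyer.BirchSwinnertonDyer.Theorems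

/-! ## §S1 The ROBUST node: K2-M♭ (the branch's big dual Selmer module, its torsion fibres, the weight-2 divisibility of its
characteristic series, and one-sided member control) — v1.1 -/

/-- **stub_branchFibreDiv** (K2-M♭, v1.1) [CONTENT — research; the ROBUST module-level form of telescope v6's research stub
`stub_carrierDivInt` (K2-D♭): same road-R-β prefix and analytic-package hypothesis TOKEN FOR TOKEN; conclusion = K2-M's with the pair
(ctrl₀) + (pure) replaced by the single WEIGHT-2 DIVISIBILITY (div₀) `p^j · φ₀(char_B X₂) ⊆ Ch_Λ(X_ac(E/K))` (`φ₀ = X ↦ 0`), i.e.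
«`Ch_Λ(X_ac(E/K))` divides `p^j·F₀(0,T)` for the characteristic series `F₀` of `X₂ := XBig κ ρ₂ 𝔭bar ∅`»; (fg), (reg₀), (reg_k), (ctrl_k) as in
K2-M. WHY THIS NODE (card rev 1.7, F8): (div₀) is implied by (ctrl₀) + (pure) through the two-sided Herbrand formula (`moduleDiv_of_module`
below, sorry-free), but it ALSO holds when (pure) FAILS by a Herbrand-matched pseudo-null piece — e.g. `P ≅ B/(X,T) ⊂ X₂` from the
split-multiplicative exceptional zero (`a_p(E) = 1`): then `char_Λ(X₂[X]) ∌ p^m`, yet `P` contributes the same factor to `char_Λ(X₂/XX₂)` and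
to `char_Λ(X₂[X])`, so `F₀(0,T)·char(X₂[X]) = char(X₂/XX₂) ⊇·⊆ Ch(X_E)·char(δ₀^∨)` still yields `Ch(X_E) ∣ p^j F₀(0,T)` once the
exceptional factor is accounted (Castella 2018 erratum §2); K2-M♭ is therefore the statement a classical proof establishes in BOTH scenarios
(no pseudo-null: `F₀(0,T) = e(T)·Ch(X_E)`; pseudo-null present: `F₀(0,T) = Ch(X_E)`), and the kernel below needs only the ONE-SIDED
Herbrand inequality (= the registered `stub_herbrandTranslate`, x2-p2 #3 by name). Classical decomposition: C1♭ branch + disc chart + finite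
generation (Hida 1986; Greenberg–Stevens 1993 §2; Greenberg 2006 Prop. 3.2), C2♭′ weight-2 control with the exceptional factor (Ochiai 2006
Prop. 5.1-shape + Greenberg–Stevens-type improved specialisation), C3♭ member control with finite `𝔭̄`-defect (Weil weight `k − 1 ≥ 2`),
C5♭/C6♭ fibre torsion (CGLS 2022 / BDP on Cell C; `L_p(g_k) ≠ 0`).
Why it might fail: on Cell C the branch is residually REDUCIBLE, so the printed control theorems do not apply verbatim; a height-one factor of
`Ch_Λ(X_ac(E/K))` prime to `p` and INVISIBLE to the family (a pseudo-null `B/(X, g(T))`, `g ∉ (p)·units`, inside `X₂` whose image in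
`X_ac(E)` is not matched by `char_B X₂`) breaks (div₀) — for `g = T` this is excluded by the exceptional-zero analysis, for other `g` it would
be a failure of the two-variable main conjecture's specialisation at weight 2; an infinite non-`p`-power `𝔭̄`-defect at a member breaks
(ctrl_k) (excluded for `k > 2` by Weil weights); the `𝔭̄`-strict big condition may need a `p`-power (whence `p^j`); `𝒪 ⊋ ℤ_p` harmless.
Sources: [cite: GreenbergStevens1993, §2] [cite: Ochiai2006, Prop. 5.1, Lemma 7.2, Cor. 7.5] [cite: Delbourgo2008, Thm. 7.15, Lemma 10.5]
[cite: Greenberg2016, Prop. 4.1.1] [cite: SkinnerUrban2014, §3.1.6, Cor. 3.2.9] [cite: Castella2018Erratum, §2 (2.5)]] -/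
theorem stub_branchFibreDiv :
    ∀ (W : WeierstrassCurve ℚ) [W.IsElliptic] [W.IsGloballyMinimal] (p : ℕ) [Fact p.Prime],
    ∀ (N : ℕ) [NeZero N] (K : Type) [Field K] [NumberField K] (Dt : ModularParametrizationData W N)
      (H : HeegnerDatum N (NumberField.discr K)) (ιK : K →+* ℂ) (P : (W.baseChange K).toAffine.Point),
      CellC W p → W.conductorNorm ℤ = N →
      IsImaginaryQuadratic K → NumberField.discr K < -4 → SatisfiesHeegnerHypothesis N K →
      (W.quadraticTwist (NumberField.discr K : ℚ)).entireLFunction 1 ≠ 0 →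
      WeierstrassCurve.Affine.Point.map ιK.toRatAlgHom P = heegnerPointComplex Dt H →
      ¬ (p : ℤ) ∣ Dt.c → ¬ IsOfFinAddOrder P →
      Odd (NumberField.discr K) →
      ∀ (κ : ZpExtension K p), κ.IsAnticyclotomic →
        ∀ (γ : Field.absoluteGaloisGroup K) [Fact (κ.IsTopGenerator γ)]
          (𝔭 : HeightOneSpectrum (𝓞 K)), ((p : ℕ) : 𝓞 K) ∈ 𝔭.asIdeal →
          𝔭.asIdeal.ramificationIdx (𝓞 ℚ) = 1 → 𝔭.asIdeal.inertiaDeg (𝓞 ℚ) = 1 →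
          ∀ (𝔭bar : HeightOneSpectrum (𝓞 K)), ((p : ℕ) : 𝓞 K) ∈ 𝔭bar.asIdeal → 𝔭bar ≠ 𝔭 →
            ((Ideal.span {(p : ℤ)}).primesOver (𝓞 K)).ncard = 2 →
          ∀ (f : CuspForm (CongruenceSubgroup.Gamma0 N) 2), IsNewformOf W f →
            ∀ (ι' : PadicAlgCl p ≃+* ℂ),
              (∀ (w : InfinitePlace K) (k : 𝓞 K),
                k ∈ 𝔭.asIdeal ↔ ‖ι'.symm (w.embedding (k : K))‖ < 1) →
              ∀ (ΩK : ℂ) (Ωp : ℂ_[p]) (Q : PowerSeries 𝓞_ℂ_[p]), ΩK ≠ 0 → ‖Ωp‖ = 1 →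
                R1.IsBDPLFunctionInt p ι' 𝔭 κ γ f ΩK Ωp Q →
      ∀ (L : PowerSeries (PowerSeries (unrIntegers p))) (x : ℕ → ℤ_[p]) (D : ℕ → Skinner2016.HidaCongruentForm W p 1),
        (∀ k, ‖x k‖ < 1) ∧ Filter.Tendsto x Filter.atTop (nhds 0) ∧
        (∃ e : ℕ, PowerSeries.C ((p : 𝓞_ℂ_[p]) ^ e) * Q ∈
          Ideal.span {PowerSeries.map (R1.unrToCpInt p) (PowerSeries.map (PowerSeries.constantCoeff (R := unrIntegers p)) L)}) ∧
        (∀ k : ℕ, (∀ y : coeffField (D k).g, ι' ((D k).ι y) = (y : ℂ)) ∧ 2 * ((p : ℤ) - 1) ∣ (D k).k - 2 ∧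
          ∃ (ΩKg : ℂ) (Ωpg : ℂ_[p]) (Lg : UnrSeries p), ΩKg ≠ 0 ∧ ‖Ωpg‖ = 1 ∧
            IsBDPLFunctionWt ι' 𝔭 κ γ (D k).g ΩKg Ωpg Lg ∧
          ∃ Ψ : UnrSeries p,
            (∃ U : PowerSeries (PowerSeries (unrIntegers p)),
              PowerSeries.map (PowerSeries.C (R := unrIntegers p)) Ψ =
                L + PowerSeries.C (PowerSeries.X - PowerSeries.C (toUnr p (x k))) * U) ∧
            (∃ e : ℕ, PowerSeries.C ((p : 𝓞_ℂ_[p]) ^ e) * PowerSeries.map (R1.unrToCpInt p) Ψ ∈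
              Ideal.span {PowerSeries.map (R1.unrToCpInt p) Lg})) ∧
        (∃ A : ℕ → UnrSeries p, ∀ ℓ : ℕ, ℓ.Prime → ¬ ℓ ∣ N →
          (∃ U : UnrSeries p, A ℓ = PowerSeries.C (toUnr p ((W.frobeniusTrace ℓ : ℤ) : ℤ_[p])) + PowerSeries.X * U) ∧
          ∀ k : ℕ, ∃ (c : unrIntegers p) (U : UnrSeries p),
            A ℓ = PowerSeries.C c + (PowerSeries.X - PowerSeries.C (toUnr p (x k))) * U ∧
            ((c : ℂ_[p]) = algebraMap (PadicAlgCl p) ℂ_[p]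
              ((D k).ι ⟨(UpperHalfPlane.qExpansion 1 ⇑(D k).g).coeff ℓ, coeff_mem_coeffField (D k).g ℓ⟩))) →
      ∃ (_ : TopologicalSpace (PowerSeries ℤ_[p])) (A₂ : Type) (_ : AddCommGroup A₂)
        (_ : Module (PowerSeries ℤ_[p]) A₂) (_ : TopologicalSpace A₂) (_ : DiscreteTopology A₂)
        (ρ₂ : ContinuousRep (Field.absoluteGaloisGroup K) (PowerSeries ℤ_[p]) A₂)
        (_ : TopologicalSpace (PowerSeries (PowerSeries ℤ_[p])))
        (_ : ContinuousSMul (PowerSeries (PowerSeries ℤ_[p])) (BigRepModule (PowerSeries ℤ_[p]) p A₂))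
        (_ : Module (PowerSeries ℤ_[p]) (XBig κ ρ₂ 𝔭bar (∅ : Set (HeightOneSpectrum (𝓞 K)))))
        (_ : IsScalarTower (PowerSeries ℤ_[p]) (PowerSeries (PowerSeries ℤ_[p]))
          (XBig κ ρ₂ 𝔭bar (∅ : Set (HeightOneSpectrum (𝓞 K))))),
        Module.Finite (PowerSeries (PowerSeries ℤ_[p])) (XBig κ ρ₂ 𝔭bar (∅ : Set (HeightOneSpectrum (𝓞 K)))) ∧
        (∃ s : PowerSeries (PowerSeries ℤ_[p]),
          ¬ (PowerSeries.C (PowerSeries.X : PowerSeries ℤ_[p]) ∣ s) ∧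
            ∀ m : XBig κ ρ₂ 𝔭bar (∅ : Set (HeightOneSpectrum (𝓞 K))), s • m = 0) ∧
        (∃ j : ℕ, Ideal.span {PowerSeries.C ((p : ℤ_[p]) ^ j)} *
            (Literature.NumberTheory.EllipticCurves.Module.charIdeal (PowerSeries (PowerSeries ℤ_[p]))
                (XBig κ ρ₂ 𝔭bar (∅ : Set (HeightOneSpectrum (𝓞 K))))).map
              (PowerSeries.map (PowerSeries.constantCoeff (R := ℤ_[p]))) ≤
          XAc.charIdeal (W.baseChange K) p κ 𝔭bar ∅ γ) ∧
        ∀ k : ℕ,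
          (∃ s : PowerSeries (PowerSeries ℤ_[p]),
            ¬ (PowerSeries.C (PowerSeries.X - PowerSeries.C (x k)) ∣ s) ∧
              ∀ m : XBig κ ρ₂ 𝔭bar (∅ : Set (HeightOneSpectrum (𝓞 K))), s • m = 0) ∧
          ∀ (b : padicCoeffIntegers (D k).ι →+* 𝓞_ℂ_[p]),
            (∀ y, ((b y : 𝓞_ℂ_[p]) : ℂ_[p]) =
              algebraMap (PadicAlgCl p) ℂ_[p] (padicCoeffIntegers.toPadicAlgCl (D k).ι y)) →
          ∀ [TopologicalSpace (PowerSeries (padicCoeffIntegers (D k).ι))]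
            [ContinuousSMul (PowerSeries (padicCoeffIntegers (D k).ι))
              (BigRepModule (padicCoeffIntegers (D k).ι) p (Cofree (D k).Δ.selfDualRep (padicCoeffField (D k).ι)))],
            ∃ j : ℕ, Ideal.span {PowerSeries.C ((p : 𝓞_ℂ_[p]) ^ j)} *
                (XBig.charIdeal κ ((D k).Δ.selfDualCofreeRepOver K) 𝔭bar
                  (∅ : Set (HeightOneSpectrum (𝓞 K)))).map (PowerSeries.map b) ≤
              (Literature.NumberTheory.EllipticCurves.Module.charIdeal (PowerSeries ℤ_[p])
                  (QuotSMulTop (PowerSeries.C (PowerSeries.X - PowerSeries.C (x k)))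
                    (XBig κ ρ₂ 𝔭bar (∅ : Set (HeightOneSpectrum (𝓞 K)))))).map
                (PowerSeries.map (R1.toCpInt p))
 := by
  sorry

/-! ## §S The one stub: K2-M (the branch's big dual Selmer module, its fibres, control and purity) -/

/-- **stub_branchFibreControl** (K2-M) [CONTENT — research; the MODULE-LEVEL form of telescope v6's research stub `stub_carrierDivInt`
(K2-D♭): same road-R-β prefix and the same analytic-package hypothesis TOKEN FOR TOKEN; conclusion: a continuous `ρ₂ : G_K → Aut_{ℤ_p⟦X⟧}(A₂)`
on a discrete `A₂` (classically `𝔸₂ = 𝕋_U ⊗ 𝕀^∨`, the cofree discrete module of the Hida branch through `f_E` on a `ℤ_p`-integral weight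
disc `U`, members at `X = x_k`) whose `𝔭̄`-strict big dual Selmer module `X₂ := XBig κ ρ₂ 𝔭bar ∅` over `B = ℤ_p⟦X⟧⟦T⟧`, with a compatible
`Λ_ac = ℤ_p⟦T⟧`-structure, is (fg) finitely generated, (reg₀)/(reg_k) killed by elements outside `(X)` / `(X − x_k)` (torsion fibres),
(ctrl₀) `p^j·char_Λ(X₂/X X₂) ⊆ Ch_Λ(X_ac(E/K))`, (pure) `(p^m) ⊆ char_Λ(X₂[X])`, (ctrl_k) `p^j·Ch(X(g_k)) ⊆ char_Λ(X₂/(X − x_k)X₂)` in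
`𝓞_{ℂ_p}⟦T⟧`. Classical decomposition: C1♭ branch + disc chart + finite generation (Hida 1986; Greenberg–Stevens 1993 §2; Greenberg 2006),
C2♭/C3♭ control with finite `𝔭̄`-local defect (Ochiai 2006 Prop. 5.1-shape; Delbourgo 2008 Thm. 7.15-shape), C4♭ no pseudo-null submodule
(Greenberg 2016 Prop. 4.1.1-shape), C5♭/C6♭ fibre torsion (CGLS 2022 / BDP on Cell C; `L_p(g_k) ≠ 0`).
Why it might fail: on Cell C the residual representation of the branch is REDUCIBLE, so the printed control / no-pseudo-null theorems
(stated for residually irreducible, `p`-distinguished families) do not apply verbatim — an infinite local defect at `𝔭̄` at an anomalous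
member (`a_p(g_k) → a_p(E) = 1`) breaks (ctrl_k), and a non-pseudo-null `X`-torsion (failure of SUR/LEO for `𝔸₂`) breaks (pure); the
`𝔭̄`-STRICT condition for the big module may need the branch's `𝔭̄`-ordinary filtration to be a direct summand integrally (true after a
`p`-power, whence the `p^j`); the disc chart may need `𝒪 ⊋ ℤ_p` (harmless: replace `ℤ_[p]`).
Sources: [cite: GreenbergStevens1993, §2] [cite: Ochiai2006, Prop. 5.1, Lemma 7.2, Cor. 7.5] [cite: Delbourgo2008, Thm. 7.15, Lemma 10.5]
[cite: Greenberg2016, Prop. 4.1.1] [cite: SkinnerUrban2014, §3.1.6, Cor. 3.2.9] [cite: Castella2018Erratum, §2]] -/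
theorem stub_branchFibreControl :
    ∀ (W : WeierstrassCurve ℚ) [W.IsElliptic] [W.IsGloballyMinimal] (p : ℕ) [Fact p.Prime],
    ∀ (N : ℕ) [NeZero N] (K : Type) [Field K] [NumberField K] (Dt : ModularParametrizationData W N)
      (H : HeegnerDatum N (NumberField.discr K)) (ιK : K →+* ℂ) (P : (W.baseChange K).toAffine.Point),
      CellC W p → W.conductorNorm ℤ = N →
      IsImaginaryQuadratic K → NumberField.discr K < -4 → SatisfiesHeegnerHypothesis N K →
      (W.quadraticTwist (NumberField.discr K : ℚ)).entireLFunction 1 ≠ 0 →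
      WeierstrassCurve.Affine.Point.map ιK.toRatAlgHom P = heegnerPointComplex Dt H →
      ¬ (p : ℤ) ∣ Dt.c → ¬ IsOfFinAddOrder P →
      Odd (NumberField.discr K) →
      ∀ (κ : ZpExtension K p), κ.IsAnticyclotomic →
        ∀ (γ : Field.absoluteGaloisGroup K) [Fact (κ.IsTopGenerator γ)]
          (𝔭 : HeightOneSpectrum (𝓞 K)), ((p : ℕ) : 𝓞 K) ∈ 𝔭.asIdeal →
          𝔭.asIdeal.ramificationIdx (𝓞 ℚ) = 1 → 𝔭.asIdeal.inertiaDeg (𝓞 ℚ) = 1 →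
          ∀ (𝔭bar : HeightOneSpectrum (𝓞 K)), ((p : ℕ) : 𝓞 K) ∈ 𝔭bar.asIdeal → 𝔭bar ≠ 𝔭 →
            ((Ideal.span {(p : ℤ)}).primesOver (𝓞 K)).ncard = 2 →
          ∀ (f : CuspForm (CongruenceSubgroup.Gamma0 N) 2), IsNewformOf W f →
            ∀ (ι' : PadicAlgCl p ≃+* ℂ),
              (∀ (w : InfinitePlace K) (k : 𝓞 K),
                k ∈ 𝔭.asIdeal ↔ ‖ι'.symm (w.embedding (k : K))‖ < 1) →
              ∀ (ΩK : ℂ) (Ωp : ℂ_[p]) (Q : PowerSeries 𝓞_ℂ_[p]), ΩK ≠ 0 → ‖Ωp‖ = 1 →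
                R1.IsBDPLFunctionInt p ι' 𝔭 κ γ f ΩK Ωp Q →
      ∀ (L : PowerSeries (PowerSeries (unrIntegers p))) (x : ℕ → ℤ_[p]) (D : ℕ → Skinner2016.HidaCongruentForm W p 1),
        (∀ k, ‖x k‖ < 1) ∧ Filter.Tendsto x Filter.atTop (nhds 0) ∧
        (∃ e : ℕ, PowerSeries.C ((p : 𝓞_ℂ_[p]) ^ e) * Q ∈
          Ideal.span {PowerSeries.map (R1.unrToCpInt p) (PowerSeries.map (PowerSeries.constantCoeff (R := unrIntegers p)) L)}) ∧
        (∀ k : ℕ, (∀ y : coeffField (D k).g, ι' ((D k).ι y) = (y : ℂ)) ∧ 2 * ((p : ℤ) - 1) ∣ (D k).k - 2 ∧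
          ∃ (ΩKg : ℂ) (Ωpg : ℂ_[p]) (Lg : UnrSeries p), ΩKg ≠ 0 ∧ ‖Ωpg‖ = 1 ∧
            IsBDPLFunctionWt ι' 𝔭 κ γ (D k).g ΩKg Ωpg Lg ∧
          ∃ Ψ : UnrSeries p,
            (∃ U : PowerSeries (PowerSeries (unrIntegers p)),
              PowerSeries.map (PowerSeries.C (R := unrIntegers p)) Ψ =
                L + PowerSeries.C (PowerSeries.X - PowerSeries.C (toUnr p (x k))) * U) ∧
            (∃ e : ℕ, PowerSeries.C ((p : 𝓞_ℂ_[p]) ^ e) * PowerSeries.map (R1.unrToCpInt p) Ψ ∈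
              Ideal.span {PowerSeries.map (R1.unrToCpInt p) Lg})) ∧
        (∃ A : ℕ → UnrSeries p, ∀ ℓ : ℕ, ℓ.Prime → ¬ ℓ ∣ N →
          (∃ U : UnrSeries p, A ℓ = PowerSeries.C (toUnr p ((W.frobeniusTrace ℓ : ℤ) : ℤ_[p])) + PowerSeries.X * U) ∧
          ∀ k : ℕ, ∃ (c : unrIntegers p) (U : UnrSeries p),
            A ℓ = PowerSeries.C c + (PowerSeries.X - PowerSeries.C (toUnr p (x k))) * U ∧
            ((c : ℂ_[p]) = algebraMap (PadicAlgCl p) ℂ_[p]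
              ((D k).ι ⟨(UpperHalfPlane.qExpansion 1 ⇑(D k).g).coeff ℓ, coeff_mem_coeffField (D k).g ℓ⟩))) →
      ∃ (_ : TopologicalSpace (PowerSeries ℤ_[p])) (A₂ : Type) (_ : AddCommGroup A₂)
        (_ : Module (PowerSeries ℤ_[p]) A₂) (_ : TopologicalSpace A₂) (_ : DiscreteTopology A₂)
        (ρ₂ : ContinuousRep (Field.absoluteGaloisGroup K) (PowerSeries ℤ_[p]) A₂)
        (_ : TopologicalSpace (PowerSeries (PowerSeries ℤ_[p])))
        (_ : ContinuousSMul (PowerSeries (PowerSeries ℤ_[p])) (BigRepModule (PowerSeries ℤ_[p]) p A₂))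
        (_ : Module (PowerSeries ℤ_[p]) (XBig κ ρ₂ 𝔭bar (∅ : Set (HeightOneSpectrum (𝓞 K)))))
        (_ : IsScalarTower (PowerSeries ℤ_[p]) (PowerSeries (PowerSeries ℤ_[p]))
          (XBig κ ρ₂ 𝔭bar (∅ : Set (HeightOneSpectrum (𝓞 K))))),
        Module.Finite (PowerSeries (PowerSeries ℤ_[p])) (XBig κ ρ₂ 𝔭bar (∅ : Set (HeightOneSpectrum (𝓞 K)))) ∧
        (∃ s : PowerSeries (PowerSeries ℤ_[p]),
          ¬ (PowerSeries.C (PowerSeries.X : PowerSeries ℤ_[p]) ∣ s) ∧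
            ∀ m : XBig κ ρ₂ 𝔭bar (∅ : Set (HeightOneSpectrum (𝓞 K))), s • m = 0) ∧
        (∃ j : ℕ, Ideal.span {PowerSeries.C ((p : ℤ_[p]) ^ j)} *
            Literature.NumberTheory.EllipticCurves.Module.charIdeal (PowerSeries ℤ_[p])
              (QuotSMulTop (PowerSeries.C (PowerSeries.X : PowerSeries ℤ_[p]))
                (XBig κ ρ₂ 𝔭bar (∅ : Set (HeightOneSpectrum (𝓞 K))))) ≤
          XAc.charIdeal (W.baseChange K) p κ 𝔭bar ∅ γ) ∧
        (∃ m : ℕ, Ideal.span {PowerSeries.C ((p : ℤ_[p]) ^ m)} ≤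
          Literature.NumberTheory.EllipticCurves.Module.charIdeal (PowerSeries ℤ_[p])
            (Submodule.torsionBy (PowerSeries (PowerSeries ℤ_[p]))
              (XBig κ ρ₂ 𝔭bar (∅ : Set (HeightOneSpectrum (𝓞 K))))
              (PowerSeries.C (PowerSeries.X : PowerSeries ℤ_[p])))) ∧
        ∀ k : ℕ,
          (∃ s : PowerSeries (PowerSeries ℤ_[p]),
            ¬ (PowerSeries.C (PowerSeries.X - PowerSeries.C (x k)) ∣ s) ∧
              ∀ m : XBig κ ρ₂ 𝔭bar (∅ : Set (HeightOneSpectrum (𝓞 K))), s • m = 0) ∧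
          ∀ (b : padicCoeffIntegers (D k).ι →+* 𝓞_ℂ_[p]),
            (∀ y, ((b y : 𝓞_ℂ_[p]) : ℂ_[p]) =
              algebraMap (PadicAlgCl p) ℂ_[p] (padicCoeffIntegers.toPadicAlgCl (D k).ι y)) →
          ∀ [TopologicalSpace (PowerSeries (padicCoeffIntegers (D k).ι))]
            [ContinuousSMul (PowerSeries (padicCoeffIntegers (D k).ι))
              (BigRepModule (padicCoeffIntegers (D k).ι) p (Cofree (D k).Δ.selfDualRep (padicCoeffField (D k).ι)))],
            ∃ j : ℕ, Ideal.span {PowerSeries.C ((p : 𝓞_ℂ_[p]) ^ j)} *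
                (XBig.charIdeal κ ((D k).Δ.selfDualCofreeRepOver K) 𝔭bar
                  (∅ : Set (HeightOneSpectrum (𝓞 K)))).map (PowerSeries.map b) ≤
              (Literature.NumberTheory.EllipticCurves.Module.charIdeal (PowerSeries ℤ_[p])
                  (QuotSMulTop (PowerSeries.C (PowerSeries.X - PowerSeries.C (x k)))
                    (XBig κ ρ₂ 𝔭bar (∅ : Set (HeightOneSpectrum (𝓞 K)))))).map
                (PowerSeries.map (R1.toCpInt p))
 := by
  sorry

/-! ## §C Local copies of LANDED tree lemmas (verbatim from x2-p2 g18's ACCEPTED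
`Theorems/EisensteinPrimesBSDpOnCellCRetractionSpecializationCyclic.lean`, p729512, namespace `…Theorems.RetractionSpecialization`;
the check farm had not built its olean at write time — a fold replaces this section by the import and the tree names) -/

namespace GenCopy

open Function
open scoped Pointwise
open Literature.NumberTheory.EllipticCurves Literature.NumberTheory.EllipticCurves.Module
open Summit.BirchSwinnertonDyer.BirchSwinnertonDyer.Theorems.SignedBaseChangeAcDivSpecialization
open Summit.BirchSwinnertonDyer.BirchSwinnertonDyer.Theorems.SignedBaseChangeAcDivSpecialization.LocalLength

universe u₁ w₁ v₁

variable {A : Type u₁} {B : Type w₁} [CommRing A] [CommRing B] {π : B} {φ : B →+* A}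

/-- `r ∈ (π)` iff `φ r = 0` (the kernel of `φ` is `(π)`). [folklore] (copy of p729512's) -/
theorem mem_span_iff_map_eq_zero (hφπ : φ π = 0) (hker : ∀ b : B, φ b = 0 → π ∣ b) {r : B} :
    r ∈ Ideal.span {π} ↔ φ r = 0 := by
  rw [Ideal.mem_span_singleton]
  refine ⟨fun ⟨c, hc⟩ => ?_, hker r⟩
  rw [hc, map_mul, hφπ, zero_mul]

/-- `ker φ = (π)`. [folklore] (copy of p729512's) -/
theorem ker_eq_span (hφπ : φ π = 0) (hker : ∀ b : B, φ b = 0 → π ∣ b) :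
    RingHom.ker φ = Ideal.span {π} := by
  ext r
  rw [RingHom.mem_ker, mem_span_iff_map_eq_zero hφπ hker]

/-- `(π)` is prime when `A` is a domain (`B/(π) ≅ A`). [folklore] (copy of p729512's) -/
theorem isPrime_span [IsDomain A] (hφπ : φ π = 0) (hker : ∀ b : B, φ b = 0 → π ∣ b) :
    (Ideal.span {π}).IsPrime := by
  rw [← ker_eq_span hφπ hker]
  exact RingHom.ker_isPrime φ

/-- `π ≠ 0` is a prime element when `A` is a domain. [folklore] (copy of p729512's) -/
theorem prime_of_ne_zero [IsDomain A] (hφπ : φ π = 0) (hker : ∀ b : B, φ b = 0 → π ∣ b)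
    (hπ0 : π ≠ 0) : Prime π :=
  (Ideal.span_singleton_prime hπ0).mp (isPrime_span hφπ hker)

/-- `(π) ⊂ B` has height one for `π ≠ 0` (`A`, `B` domains). [folklore] (copy of p729512's) -/
theorem height_span_eq_one [IsDomain A] [IsDomain B] [IsNoetherianRing B] (hφπ : φ π = 0)
    (hker : ∀ b : B, φ b = 0 → π ∣ b) (hπ0 : π ≠ 0) : (Ideal.span {π}).height = 1 :=
  height_span_singleton_eq_one_of_prime (prime_of_ne_zero hφπ hker hπ0)

variable {N : Type v₁} [AddCommGroup N] [Module B N]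
variable [IsDomain A] [IsDomain B] [IsNoetherianRing B] [UniqueFactorizationMonoid B]

/-- For a module `N` over the factorial ring `B` killed by some `s` with `φ s ≠ 0` (and `π ≠ 0`), the characteristic
ideal is principal with a generator `F` satisfying `φ F ≠ 0`. [folklore] (copy of p729512's) -/
theorem exists_charIdeal_eq_span_of_retraction (hφπ : φ π = 0) (hker : ∀ b : B, φ b = 0 → π ∣ b)
    (hπ0 : π ≠ 0) {s : B} (hs0 : φ s ≠ 0) (hs : ∀ m : N, s • m = 0) :
    ∃ F : B, charIdeal B N = Ideal.span {F} ∧ φ F ≠ 0 := by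
  obtain ⟨F, hF⟩ := (isPrincipal_charIdeal_of_ufm (R := B) (M := N)).principal
  refine ⟨F, hF, fun hc => ?_⟩
  let PX : PrimeSpectrum B := ⟨Ideal.span {π}, isPrime_span hφπ hker⟩
  have hle : charIdeal B N ≤ PX.asIdeal := by
    rw [hF]
    exact (Ideal.span_singleton_le_iff_mem _).mpr ((mem_span_iff_map_eq_zero hφπ hker).mpr hc)
  refine lengthAt_ne_zero_of_charIdeal_le (𝔮 := PX) (height_span_eq_one hφπ hker hπ0) hle ?_
  exact lengthAt_eq_zero_of_isTorsionBy (s := s) (fun m => hs m) PX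
    (fun h => hs0 ((mem_span_iff_map_eq_zero hφπ hker).mp h))

end GenCopy

/-! ## §L Coefficient lemmas (generic; theorems only) -/

section Coeff

variable {R : Type*} [CommRing R]

/-- `C a ∣ G` in `R⟦T⟧` as soon as `a` divides every coefficient. [folklore] -/
theorem C_dvd_of_forall_dvd_coeff (a : R) (G : PowerSeries R) (h : ∀ n, a ∣ PowerSeries.coeff n G) :
    PowerSeries.C a ∣ G := by
  choose q hq using h
  refine ⟨PowerSeries.mk q, PowerSeries.ext fun n => ?_⟩
  rw [PowerSeries.coeff_C_mul, PowerSeries.coeff_mk]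
  exact hq n

/-- `X ↦ 0` in the inner variable is a retraction of the inner-constant embedding `R⟦T⟧ → R⟦X⟧⟦T⟧`. [folklore] -/
theorem map_constantCoeff_map_C (g : PowerSeries R) :
    PowerSeries.map (PowerSeries.constantCoeff (R := R)) (PowerSeries.map (PowerSeries.C (R := R)) g) = g := by
  refine PowerSeries.ext fun n => ?_
  simp only [PowerSeries.coeff_map, PowerSeries.constantCoeff_C]

/-- The kernel of `X ↦ 0` (inner variable) is `(X)`: `map constantCoeff G = 0 → C X ∣ G`. [folklore] -/
theorem C_X_dvd_of_map_constantCoeff_eq_zero (G : PowerSeries (PowerSeries R))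
    (h : PowerSeries.map (PowerSeries.constantCoeff (R := R)) G = 0) :
    PowerSeries.C (PowerSeries.X : PowerSeries R) ∣ G := by
  refine C_dvd_of_forall_dvd_coeff _ _ fun n => ?_
  rw [PowerSeries.X_dvd_iff]
  have h1 := congrArg (PowerSeries.coeff n) h
  rw [PowerSeries.coeff_map, map_zero] at h1
  exact h1

end Coeff

/-! ## §K The kernel: K2-M ⟹ K2-D♭ (telescope v6's `stub_carrierDivInt` = `K2Int.stub_carrierDivInt`, text VERBATIM), given the
two-sided Herbrand formula along a retraction (x2-p2 g18, p729686, by name once built) -/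

set_option maxHeartbeats 1600000 in
/-- **K2-D♭ from K2-M.** `F₀ :=` a generator of `char_B(X₂)` with `F₀(0,T) ≠ 0` (§C at the retraction `X ↦ 0`, from (reg₀));
(nondeg) `X ∤ F₀`; (alg∞) `p^{j+m}·F₀(0,T) ∈ Ch_Λ(X_ac(E/K))` from the two-sided Herbrand formula `hHer2` at `X ↦ 0`, (pure) and
(ctrl₀), read in `𝓞_{ℂ_p}⟦T⟧`; per member `Φ₀ := F₀(x_k,T) ≠ 0` (generators are associated; the one at `X ↦ x_k` has non-zero image by
(reg_k)), `Φ₀ ≡ F₀ (mod X − x_k)` (LEAD's landed `TelescopeCarrierAlgOfWitness.C_dvd_of_evAtMap_eq_zero`, `𝒪 = ℤ_p`), and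
`char_Λ(X₂/(X − x_k)X₂) ⊆ (Φ₀)` (one-sided half of `hHer2`) under (ctrl_k). `hHer2` is x2-p2 g18's
`RetractionSpecialization.charIdeal_quotSMulTop_eq_mul_of_retraction` (p729686) at universe 0. Sorry-free. -/
theorem carrierDivInt_of_module
    (hM :
    ∀ (W : WeierstrassCurve ℚ) [W.IsElliptic] [W.IsGloballyMinimal] (p : ℕ) [Fact p.Prime],
    ∀ (N : ℕ) [NeZero N] (K : Type) [Field K] [NumberField K] (Dt : ModularParametrizationData W N)
      (H : HeegnerDatum N (NumberField.discr K)) (ιK : K →+* ℂ) (P : (W.baseChange K).toAffine.Point),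
      CellC W p → W.conductorNorm ℤ = N →
      IsImaginaryQuadratic K → NumberField.discr K < -4 → SatisfiesHeegnerHypothesis N K →
      (W.quadraticTwist (NumberField.discr K : ℚ)).entireLFunction 1 ≠ 0 →
      WeierstrassCurve.Affine.Point.map ιK.toRatAlgHom P = heegnerPointComplex Dt H →
      ¬ (p : ℤ) ∣ Dt.c → ¬ IsOfFinAddOrder P →
      Odd (NumberField.discr K) →
      ∀ (κ : ZpExtension K p), κ.IsAnticyclotomic →
        ∀ (γ : Field.absoluteGaloisGroup K) [Fact (κ.IsTopGenerator γ)]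
          (𝔭 : HeightOneSpectrum (𝓞 K)), ((p : ℕ) : 𝓞 K) ∈ 𝔭.asIdeal →
          𝔭.asIdeal.ramificationIdx (𝓞 ℚ) = 1 → 𝔭.asIdeal.inertiaDeg (𝓞 ℚ) = 1 →
          ∀ (𝔭bar : HeightOneSpectrum (𝓞 K)), ((p : ℕ) : 𝓞 K) ∈ 𝔭bar.asIdeal → 𝔭bar ≠ 𝔭 →
            ((Ideal.span {(p : ℤ)}).primesOver (𝓞 K)).ncard = 2 →
          ∀ (f : CuspForm (CongruenceSubgroup.Gamma0 N) 2), IsNewformOf W f →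
            ∀ (ι' : PadicAlgCl p ≃+* ℂ),
              (∀ (w : InfinitePlace K) (k : 𝓞 K),
                k ∈ 𝔭.asIdeal ↔ ‖ι'.symm (w.embedding (k : K))‖ < 1) →
              ∀ (ΩK : ℂ) (Ωp : ℂ_[p]) (Q : PowerSeries 𝓞_ℂ_[p]), ΩK ≠ 0 → ‖Ωp‖ = 1 →
                R1.IsBDPLFunctionInt p ι' 𝔭 κ γ f ΩK Ωp Q →
      ∀ (L : PowerSeries (PowerSeries (unrIntegers p))) (x : ℕ → ℤ_[p]) (D : ℕ → Skinner2016.HidaCongruentForm W p 1),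
        (∀ k, ‖x k‖ < 1) ∧ Filter.Tendsto x Filter.atTop (nhds 0) ∧
        (∃ e : ℕ, PowerSeries.C ((p : 𝓞_ℂ_[p]) ^ e) * Q ∈
          Ideal.span {PowerSeries.map (R1.unrToCpInt p) (PowerSeries.map (PowerSeries.constantCoeff (R := unrIntegers p)) L)}) ∧
        (∀ k : ℕ, (∀ y : coeffField (D k).g, ι' ((D k).ι y) = (y : ℂ)) ∧ 2 * ((p : ℤ) - 1) ∣ (D k).k - 2 ∧
          ∃ (ΩKg : ℂ) (Ωpg : ℂ_[p]) (Lg : UnrSeries p), ΩKg ≠ 0 ∧ ‖Ωpg‖ = 1 ∧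
            IsBDPLFunctionWt ι' 𝔭 κ γ (D k).g ΩKg Ωpg Lg ∧
          ∃ Ψ : UnrSeries p,
            (∃ U : PowerSeries (PowerSeries (unrIntegers p)),
              PowerSeries.map (PowerSeries.C (R := unrIntegers p)) Ψ =
                L + PowerSeries.C (PowerSeries.X - PowerSeries.C (toUnr p (x k))) * U) ∧
            (∃ e : ℕ, PowerSeries.C ((p : 𝓞_ℂ_[p]) ^ e) * PowerSeries.map (R1.unrToCpInt p) Ψ ∈
              Ideal.span {PowerSeries.map (R1.unrToCpInt p) Lg})) ∧
        (∃ A : ℕ → UnrSeries p, ∀ ℓ : ℕ, ℓ.Prime → ¬ ℓ ∣ N →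
          (∃ U : UnrSeries p, A ℓ = PowerSeries.C (toUnr p ((W.frobeniusTrace ℓ : ℤ) : ℤ_[p])) + PowerSeries.X * U) ∧
          ∀ k : ℕ, ∃ (c : unrIntegers p) (U : UnrSeries p),
            A ℓ = PowerSeries.C c + (PowerSeries.X - PowerSeries.C (toUnr p (x k))) * U ∧
            ((c : ℂ_[p]) = algebraMap (PadicAlgCl p) ℂ_[p]
              ((D k).ι ⟨(UpperHalfPlane.qExpansion 1 ⇑(D k).g).coeff ℓ, coeff_mem_coeffField (D k).g ℓ⟩))) →
      ∃ (_ : TopologicalSpace (PowerSeries ℤ_[p])) (A₂ : Type) (_ : AddCommGroup A₂)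
        (_ : Module (PowerSeries ℤ_[p]) A₂) (_ : TopologicalSpace A₂) (_ : DiscreteTopology A₂)
        (ρ₂ : ContinuousRep (Field.absoluteGaloisGroup K) (PowerSeries ℤ_[p]) A₂)
        (_ : TopologicalSpace (PowerSeries (PowerSeries ℤ_[p])))
        (_ : ContinuousSMul (PowerSeries (PowerSeries ℤ_[p])) (BigRepModule (PowerSeries ℤ_[p]) p A₂))
        (_ : Module (PowerSeries ℤ_[p]) (XBig κ ρ₂ 𝔭bar (∅ : Set (HeightOneSpectrum (𝓞 K)))))
        (_ : IsScalarTower (PowerSeries ℤ_[p]) (PowerSeries (PowerSeries ℤ_[p]))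
          (XBig κ ρ₂ 𝔭bar (∅ : Set (HeightOneSpectrum (𝓞 K))))),
        Module.Finite (PowerSeries (PowerSeries ℤ_[p])) (XBig κ ρ₂ 𝔭bar (∅ : Set (HeightOneSpectrum (𝓞 K)))) ∧
        (∃ s : PowerSeries (PowerSeries ℤ_[p]),
          ¬ (PowerSeries.C (PowerSeries.X : PowerSeries ℤ_[p]) ∣ s) ∧
            ∀ m : XBig κ ρ₂ 𝔭bar (∅ : Set (HeightOneSpectrum (𝓞 K))), s • m = 0) ∧
        (∃ j : ℕ, Ideal.span {PowerSeries.C ((p : ℤ_[p]) ^ j)} *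
            Literature.NumberTheory.EllipticCurves.Module.charIdeal (PowerSeries ℤ_[p])
              (QuotSMulTop (PowerSeries.C (PowerSeries.X : PowerSeries ℤ_[p]))
                (XBig κ ρ₂ 𝔭bar (∅ : Set (HeightOneSpectrum (𝓞 K))))) ≤
          XAc.charIdeal (W.baseChange K) p κ 𝔭bar ∅ γ) ∧
        (∃ m : ℕ, Ideal.span {PowerSeries.C ((p : ℤ_[p]) ^ m)} ≤
          Literature.NumberTheory.EllipticCurves.Module.charIdeal (PowerSeries ℤ_[p])
            (Submodule.torsionBy (PowerSeries (PowerSeries ℤ_[p]))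
              (XBig κ ρ₂ 𝔭bar (∅ : Set (HeightOneSpectrum (𝓞 K))))
              (PowerSeries.C (PowerSeries.X : PowerSeries ℤ_[p])))) ∧
        ∀ k : ℕ,
          (∃ s : PowerSeries (PowerSeries ℤ_[p]),
            ¬ (PowerSeries.C (PowerSeries.X - PowerSeries.C (x k)) ∣ s) ∧
              ∀ m : XBig κ ρ₂ 𝔭bar (∅ : Set (HeightOneSpectrum (𝓞 K))), s • m = 0) ∧
          ∀ (b : padicCoeffIntegers (D k).ι →+* 𝓞_ℂ_[p]),
            (∀ y, ((b y : 𝓞_ℂ_[p]) : ℂ_[p]) =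
              algebraMap (PadicAlgCl p) ℂ_[p] (padicCoeffIntegers.toPadicAlgCl (D k).ι y)) →
          ∀ [TopologicalSpace (PowerSeries (padicCoeffIntegers (D k).ι))]
            [ContinuousSMul (PowerSeries (padicCoeffIntegers (D k).ι))
              (BigRepModule (padicCoeffIntegers (D k).ι) p (Cofree (D k).Δ.selfDualRep (padicCoeffField (D k).ι)))],
            ∃ j : ℕ, Ideal.span {PowerSeries.C ((p : 𝓞_ℂ_[p]) ^ j)} *
                (XBig.charIdeal κ ((D k).Δ.selfDualCofreeRepOver K) 𝔭bar
                  (∅ : Set (HeightOneSpectrum (𝓞 K)))).map (PowerSeries.map b) ≤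
              (Literature.NumberTheory.EllipticCurves.Module.charIdeal (PowerSeries ℤ_[p])
                  (QuotSMulTop (PowerSeries.C (PowerSeries.X - PowerSeries.C (x k)))
                    (XBig κ ρ₂ 𝔭bar (∅ : Set (HeightOneSpectrum (𝓞 K)))))).map
                (PowerSeries.map (R1.toCpInt p))
    )
    (hHer2 : ∀ (A B : Type) [CommRing A] [CommRing B] [Algebra A B] [IsDomain A] [IsNoetherianRing A]
      [UniqueFactorizationMonoid A] [IsDomain B] [IsNoetherianRing B] [UniqueFactorizationMonoid B]
      (π : B) (φ : B →+* A), (∀ a : A, φ (algebraMap A B a) = a) → φ π = 0 → (∀ b : B, φ b = 0 → π ∣ b) → π ≠ 0 →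
      ∀ (N : Type) [AddCommGroup N] [Module B N] [Module.Finite B N] [Module A N] [IsScalarTower A B N],
        (∃ s : B, φ s ≠ 0 ∧ ∀ m : N, s • m = 0) →
        Literature.NumberTheory.EllipticCurves.Module.charIdeal A (QuotSMulTop π N) =
          Literature.NumberTheory.EllipticCurves.Module.charIdeal A (Submodule.torsionBy B N π) *
            (Literature.NumberTheory.EllipticCurves.Module.charIdeal B N).map φ) :
    ∀ (W : WeierstrassCurve ℚ) [W.IsElliptic] [W.IsGloballyMinimal] (p : ℕ) [Fact p.Prime],
    ∀ (N : ℕ) [NeZero N] (K : Type) [Field K] [NumberField K] (Dt : ModularParametrizationData W N)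
      (H : HeegnerDatum N (NumberField.discr K)) (ιK : K →+* ℂ) (P : (W.baseChange K).toAffine.Point),
      CellC W p → W.conductorNorm ℤ = N →
      IsImaginaryQuadratic K → NumberField.discr K < -4 → SatisfiesHeegnerHypothesis N K →
      (W.quadraticTwist (NumberField.discr K : ℚ)).entireLFunction 1 ≠ 0 →
      WeierstrassCurve.Affine.Point.map ιK.toRatAlgHom P = heegnerPointComplex Dt H →
      ¬ (p : ℤ) ∣ Dt.c → ¬ IsOfFinAddOrder P →
      Odd (NumberField.discr K) →
      ∀ (κ : ZpExtension K p), κ.IsAnticyclotomic →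
        ∀ (γ : Field.absoluteGaloisGroup K) [Fact (κ.IsTopGenerator γ)]
          (𝔭 : HeightOneSpectrum (𝓞 K)), ((p : ℕ) : 𝓞 K) ∈ 𝔭.asIdeal →
          𝔭.asIdeal.ramificationIdx (𝓞 ℚ) = 1 → 𝔭.asIdeal.inertiaDeg (𝓞 ℚ) = 1 →
          ∀ (𝔭bar : HeightOneSpectrum (𝓞 K)), ((p : ℕ) : 𝓞 K) ∈ 𝔭bar.asIdeal → 𝔭bar ≠ 𝔭 →
            ((Ideal.span {(p : ℤ)}).primesOver (𝓞 K)).ncard = 2 →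
          ∀ (f : CuspForm (CongruenceSubgroup.Gamma0 N) 2), IsNewformOf W f →
            ∀ (ι' : PadicAlgCl p ≃+* ℂ),
              (∀ (w : InfinitePlace K) (k : 𝓞 K),
                k ∈ 𝔭.asIdeal ↔ ‖ι'.symm (w.embedding (k : K))‖ < 1) →
              ∀ (ΩK : ℂ) (Ωp : ℂ_[p]) (Q : PowerSeries 𝓞_ℂ_[p]), ΩK ≠ 0 → ‖Ωp‖ = 1 →
                R1.IsBDPLFunctionInt p ι' 𝔭 κ γ f ΩK Ωp Q →
      ∀ (L : PowerSeries (PowerSeries (unrIntegers p))) (x : ℕ → ℤ_[p]) (D : ℕ → Skinner2016.HidaCongruentForm W p 1),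
        (∀ k, ‖x k‖ < 1) ∧ Filter.Tendsto x Filter.atTop (nhds 0) ∧
        (∃ e : ℕ, PowerSeries.C ((p : 𝓞_ℂ_[p]) ^ e) * Q ∈
          Ideal.span {PowerSeries.map (R1.unrToCpInt p) (PowerSeries.map (PowerSeries.constantCoeff (R := unrIntegers p)) L)}) ∧
        (∀ k : ℕ, (∀ y : coeffField (D k).g, ι' ((D k).ι y) = (y : ℂ)) ∧ 2 * ((p : ℤ) - 1) ∣ (D k).k - 2 ∧
          ∃ (ΩKg : ℂ) (Ωpg : ℂ_[p]) (Lg : UnrSeries p), ΩKg ≠ 0 ∧ ‖Ωpg‖ = 1 ∧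
            IsBDPLFunctionWt ι' 𝔭 κ γ (D k).g ΩKg Ωpg Lg ∧
          ∃ Ψ : UnrSeries p,
            (∃ U : PowerSeries (PowerSeries (unrIntegers p)),
              PowerSeries.map (PowerSeries.C (R := unrIntegers p)) Ψ =
                L + PowerSeries.C (PowerSeries.X - PowerSeries.C (toUnr p (x k))) * U) ∧
            (∃ e : ℕ, PowerSeries.C ((p : 𝓞_ℂ_[p]) ^ e) * PowerSeries.map (R1.unrToCpInt p) Ψ ∈
              Ideal.span {PowerSeries.map (R1.unrToCpInt p) Lg})) ∧
        (∃ A : ℕ → UnrSeries p, ∀ ℓ : ℕ, ℓ.Prime → ¬ ℓ ∣ N →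
          (∃ U : UnrSeries p, A ℓ = PowerSeries.C (toUnr p ((W.frobeniusTrace ℓ : ℤ) : ℤ_[p])) + PowerSeries.X * U) ∧
          ∀ k : ℕ, ∃ (c : unrIntegers p) (U : UnrSeries p),
            A ℓ = PowerSeries.C c + (PowerSeries.X - PowerSeries.C (toUnr p (x k))) * U ∧
            ((c : ℂ_[p]) = algebraMap (PadicAlgCl p) ℂ_[p]
              ((D k).ι ⟨(UpperHalfPlane.qExpansion 1 ⇑(D k).g).coeff ℓ, coeff_mem_coeffField (D k).g ℓ⟩))) →
      ∃ F₀ : PowerSeries (PowerSeries ℤ_[p]),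
        ¬ (PowerSeries.C (PowerSeries.X : PowerSeries ℤ_[p]) ∣ F₀) ∧
        (∃ j : ℕ, PowerSeries.C ((p : 𝓞_ℂ_[p]) ^ j) *
            PowerSeries.map (R1.toCpInt p) (PowerSeries.map (PowerSeries.constantCoeff (R := ℤ_[p])) F₀) ∈
          (XAc.charIdeal (W.baseChange K) p κ 𝔭bar ∅ γ).map (PowerSeries.map (R1.toCpInt p))) ∧
        ∀ k : ℕ, ∃ Φ₀ : PowerSeries ℤ_[p], Φ₀ ≠ 0 ∧
          (∃ U : PowerSeries (PowerSeries ℤ_[p]),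
            PowerSeries.map (PowerSeries.C (R := ℤ_[p])) Φ₀ =
              F₀ + PowerSeries.C (PowerSeries.X - PowerSeries.C (x k)) * U) ∧
          ∀ (b : padicCoeffIntegers (D k).ι →+* 𝓞_ℂ_[p]),
            (∀ y, ((b y : 𝓞_ℂ_[p]) : ℂ_[p]) =
              algebraMap (PadicAlgCl p) ℂ_[p] (padicCoeffIntegers.toPadicAlgCl (D k).ι y)) →
          ∀ [TopologicalSpace (PowerSeries (padicCoeffIntegers (D k).ι))]
            [ContinuousSMul (PowerSeries (padicCoeffIntegers (D k).ι))
              (BigRepModule (padicCoeffIntegers (D k).ι) p (Cofree (D k).Δ.selfDualRep (padicCoeffField (D k).ι)))],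
            ∃ j : ℕ, Ideal.span {PowerSeries.C ((p : 𝓞_ℂ_[p]) ^ j)} *
                (XBig.charIdeal κ ((D k).Δ.selfDualCofreeRepOver K) 𝔭bar
                  (∅ : Set (HeightOneSpectrum (𝓞 K)))).map (PowerSeries.map b) ≤
              Ideal.span {PowerSeries.map (R1.toCpInt p) Φ₀}
 := by
  intro W _ _ p _ N _ K _ _ Dt H ιK P hC hN hK hdisc hHeeg hL1 hP hc hfin hodd κ hκ γ _ 𝔭 h𝔭 hram hdeg 𝔭bar
    h𝔭bar hne hsp f hf ι' hι' ΩK Ωp Q hΩK hΩp hQ L x D hpkg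
  obtain ⟨τ₁, A₂, _iA1, _iA2, _iA3, _iA4, ρ₂, τ₂, _iC, _iM, _iT, hfg, ⟨s₀, hs₀π, hs₀⟩, ⟨j₀, hj₀⟩, ⟨m₀, hm₀⟩,
      hmem⟩ :=
    hM W p N K Dt H ιK P hC hN hK hdisc hHeeg hL1 hP hc hfin hodd κ hκ γ 𝔭 h𝔭 hram hdeg 𝔭bar h𝔭bar hne
      hsp f hf ι' hι' ΩK Ωp Q hΩK hΩp hQ L x D hpkg
  have hxk : ∀ k, ‖x k‖ < 1 := hpkg.1
  -- the rings: `A = ℤ_p⟦T⟧` (factorial: Mathlib), `B = ℤ_p⟦X⟧⟦T⟧` (factorial: regular local, Auslander–Buchsbaum, tree)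
  haveI : UniqueFactorizationMonoid (PowerSeries (PowerSeries ℤ_[p])) :=
    Literature.NumberTheory.IwasawaTheory.uniqueFactorizationMonoid_powerSeries_powerSeries ℤ_[p]
  haveI : Module.Finite (PowerSeries (PowerSeries ℤ_[p]))
      (XBig κ ρ₂ 𝔭bar (∅ : Set (HeightOneSpectrum (𝓞 K)))) := hfg
  -- the retraction `φ₀ = (X ↦ 0) : ℤ_p⟦X⟧⟦T⟧ → ℤ_p⟦T⟧`, kernel `(C X)`
  have hφ₀C : ∀ g : PowerSeries ℤ_[p],
      (PowerSeries.map (PowerSeries.constantCoeff (R := ℤ_[p])))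
        (algebraMap (PowerSeries ℤ_[p]) (PowerSeries (PowerSeries ℤ_[p])) g) = g :=
    fun g => map_constantCoeff_map_C g
  have hφ₀π : (PowerSeries.map (PowerSeries.constantCoeff (R := ℤ_[p])))
      (PowerSeries.C (PowerSeries.X : PowerSeries ℤ_[p])) = 0 := by
    rw [PowerSeries.map_C, PowerSeries.constantCoeff_X, map_zero]
  have hφ₀ker : ∀ b : PowerSeries (PowerSeries ℤ_[p]),
      (PowerSeries.map (PowerSeries.constantCoeff (R := ℤ_[p]))) b = 0 →
        PowerSeries.C (PowerSeries.X : PowerSeries ℤ_[p]) ∣ b :=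
    fun b hb => C_X_dvd_of_map_constantCoeff_eq_zero b hb
  have hπ₀0 : (PowerSeries.C (PowerSeries.X : PowerSeries ℤ_[p]) : PowerSeries (PowerSeries ℤ_[p])) ≠ 0 := by
    intro h
    have h1 := congrArg (PowerSeries.constantCoeff (R := PowerSeries ℤ_[p])) h
    rw [PowerSeries.constantCoeff_C, map_zero] at h1
    exact PowerSeries.X_ne_zero h1
  -- `F₀` := a generator of `char_B(X₂)` with `F₀(0,T) ≠ 0`
  obtain ⟨F₀, hF₀, hφF₀⟩ := GenCopy.exists_charIdeal_eq_span_of_retraction (A := PowerSeries ℤ_[p])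
    (N := XBig κ ρ₂ 𝔭bar (∅ : Set (HeightOneSpectrum (𝓞 K)))) hφ₀π hφ₀ker hπ₀0 (s := s₀)
    (fun h => hs₀π (hφ₀ker _ h)) hs₀
  -- (nondeg)
  have hX₀ : ¬ (PowerSeries.C (PowerSeries.X : PowerSeries ℤ_[p]) ∣ F₀) := by
    rintro ⟨G, hG⟩
    apply hφF₀
    rw [hG, map_mul, hφ₀π, zero_mul]
  -- (alg∞): two-sided Herbrand at `X ↦ 0` + (pure) + (ctrl₀), read in `𝓞_{ℂ_p}⟦T⟧`
  have hH₀ := hHer2 (PowerSeries ℤ_[p]) (PowerSeries (PowerSeries ℤ_[p])) _ _ hφ₀C hφ₀π hφ₀ker hπ₀0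
    (XBig κ ρ₂ 𝔭bar (∅ : Set (HeightOneSpectrum (𝓞 K)))) ⟨s₀, fun h => hs₀π (hφ₀ker _ h), hs₀⟩
  have halg : ∃ j : ℕ, PowerSeries.C ((p : 𝓞_ℂ_[p]) ^ j) *
      PowerSeries.map (R1.toCpInt p) (PowerSeries.map (PowerSeries.constantCoeff (R := ℤ_[p])) F₀) ∈
        (XAc.charIdeal (W.baseChange K) p κ 𝔭bar ∅ γ).map (PowerSeries.map (R1.toCpInt p)) := by
    refine ⟨j₀ + m₀, ?_⟩
    have h1 : PowerSeries.C ((p : ℤ_[p]) ^ m₀) *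
        PowerSeries.map (PowerSeries.constantCoeff (R := ℤ_[p])) F₀ ∈
        Literature.NumberTheory.EllipticCurves.Module.charIdeal (PowerSeries ℤ_[p])
          (QuotSMulTop (PowerSeries.C (PowerSeries.X : PowerSeries ℤ_[p]))
            (XBig κ ρ₂ 𝔭bar (∅ : Set (HeightOneSpectrum (𝓞 K))))) := by
      rw [hH₀, hF₀, Ideal.map_span, Set.image_singleton]
      exact Ideal.mul_mem_mul (hm₀ (Ideal.mem_span_singleton_self _)) (Ideal.mem_span_singleton_self _)
    have h2 : PowerSeries.C ((p : ℤ_[p]) ^ j₀) * (PowerSeries.C ((p : ℤ_[p]) ^ m₀) *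
        PowerSeries.map (PowerSeries.constantCoeff (R := ℤ_[p])) F₀) ∈
        XAc.charIdeal (W.baseChange K) p κ 𝔭bar ∅ γ :=
      hj₀ (Ideal.mul_mem_mul (Ideal.mem_span_singleton_self _) h1)
    have h3 := Ideal.mem_map_of_mem (PowerSeries.map (R1.toCpInt p)) h2
    rw [← mul_assoc, ← map_mul, ← pow_add, map_mul, PowerSeries.map_C, map_pow, map_natCast] at h3
    exact h3
  refine ⟨F₀, hX₀, halg, fun k => ?_⟩
  -- member `k`: the evaluation retraction `φ_k = (X ↦ x_k)`, kernel `(C (X − C x_k))` (LEAD's landed §E, `𝒪 = ℤ_p`)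
  obtain ⟨⟨s, hsπ, hs⟩, hctrl⟩ := hmem k
  have ha : x k ∈ IsLocalRing.maximalIdeal ℤ_[p] := by
    rw [PadicInt.maximalIdeal_eq_span_p, Ideal.mem_span_singleton]
    exact (PadicInt.norm_lt_one_iff_dvd (x k)).mp (hxk k)
  let φ : PowerSeries (PowerSeries ℤ_[p]) →+* PowerSeries ℤ_[p] :=
    PowerSeries.map (AccumHelpers.evAt (x k) ha).toRingHom
  have hφC : ∀ g : PowerSeries ℤ_[p],
      φ (algebraMap (PowerSeries ℤ_[p]) (PowerSeries (PowerSeries ℤ_[p])) g) = g :=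
    fun g => TelescopeCarrierAlgOfWitness.evAtMap_map_C _ ha g
  have hφC' : ∀ g : PowerSeries ℤ_[p], φ (PowerSeries.map (PowerSeries.C (R := ℤ_[p])) g) = g :=
    fun g => TelescopeCarrierAlgOfWitness.evAtMap_map_C _ ha g
  have hφπ : φ (PowerSeries.C (PowerSeries.X - PowerSeries.C (x k))) = 0 :=
    TelescopeCarrierAlgOfWitness.evAtMap_pi _ ha
  have hφker : ∀ b : PowerSeries (PowerSeries ℤ_[p]), φ b = 0 →
      PowerSeries.C (PowerSeries.X - PowerSeries.C (x k)) ∣ b :=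
    fun b hb => TelescopeCarrierAlgOfWitness.C_dvd_of_evAtMap_eq_zero _ ha b hb
  have hπ0 : (PowerSeries.C (PowerSeries.X - PowerSeries.C (x k)) : PowerSeries (PowerSeries ℤ_[p])) ≠ 0 := by
    intro h
    have h1 := congrArg (PowerSeries.constantCoeff (R := PowerSeries ℤ_[p])) h
    rw [PowerSeries.constantCoeff_C, map_zero, sub_eq_zero] at h1
    have h2 := congrArg (PowerSeries.coeff 1) h1
    rw [PowerSeries.coeff_one_X, PowerSeries.coeff_C, if_neg one_ne_zero] at h2
    exact one_ne_zero h2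
  -- `Φ₀ := F₀(x_k,T) ≠ 0`: the generator at `π_k` has `φ_k ≠ 0` and is associated with `F₀`
  obtain ⟨Fk, hFk, hφFk⟩ := GenCopy.exists_charIdeal_eq_span_of_retraction (A := PowerSeries ℤ_[p])
    (N := XBig κ ρ₂ 𝔭bar (∅ : Set (HeightOneSpectrum (𝓞 K)))) hφπ hφker hπ0 (s := s)
    (fun h => hsπ (hφker _ h)) hs
  have hΦ0 : φ F₀ ≠ 0 := by
    intro h0
    apply hφFk
    have hass : Associated F₀ Fk := by
      rw [← Ideal.span_singleton_eq_span_singleton, ← hF₀, ← hFk]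
    obtain ⟨u, hu⟩ := hass
    rw [← hu, map_mul, h0, zero_mul]
  refine ⟨φ F₀, hΦ0, ?_, ?_⟩
  · -- remainder form `F₀(x_k,T) ≡ F₀ (mod X − x_k)`
    have hdvd : PowerSeries.C (PowerSeries.X - PowerSeries.C (x k)) ∣
        PowerSeries.map (PowerSeries.C (R := ℤ_[p])) (φ F₀) - F₀ := by
      refine hφker _ ?_
      rw [map_sub, hφC', sub_self]
    obtain ⟨U, hU⟩ := hdvd
    exact ⟨U, by rw [← hU, add_sub_cancel]⟩
  · -- one-sided Herbrand at `X ↦ x_k` under (ctrl_k), read in `𝓞_{ℂ_p}⟦T⟧`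
    intro b hb _ _
    obtain ⟨j, hj⟩ := hctrl b hb
    refine ⟨j, hj.trans ?_⟩
    have hHk := hHer2 (PowerSeries ℤ_[p]) (PowerSeries (PowerSeries ℤ_[p])) _ φ hφC hφπ hφker hπ0
      (XBig κ ρ₂ 𝔭bar (∅ : Set (HeightOneSpectrum (𝓞 K)))) ⟨s, fun h => hsπ (hφker _ h), hs⟩
    rw [hHk, hF₀, Ideal.map_span, Set.image_singleton, Ideal.map_mul, Ideal.map_span, Set.image_singleton]
    exact Ideal.mul_le_left


/-! ## §K1 (v1.1) The robust kernel: K2-M♭ ⟹ K2-D♭, given only the ONE-SIDED Herbrand inequality (= the REGISTERED stub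
`stub_herbrandTranslate` of line «telescope» v4, text verbatim; x2-p2 g18 #3 `TelescopeHerbrandTranslate.stub_herbrandTranslate` by name) -/

set_option maxHeartbeats 1600000 in
/-- **K2-D♭ from K2-M♭.** As `carrierDivInt_of_module`, except that (alg∞) is read off (div₀) directly (`(char_B X₂).map φ₀ = (F₀(0,T))`)
and the member step uses the one-sided Herbrand inequality `hHer1` (the registered `stub_herbrandTranslate` text, universe 0). Sorry-free. -/
theorem carrierDivInt_of_moduleDiv
    (hM :
    ∀ (W : WeierstrassCurve ℚ) [W.IsElliptic] [W.IsGloballyMinimal] (p : ℕ) [Fact p.Prime],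
    ∀ (N : ℕ) [NeZero N] (K : Type) [Field K] [NumberField K] (Dt : ModularParametrizationData W N)
      (H : HeegnerDatum N (NumberField.discr K)) (ιK : K →+* ℂ) (P : (W.baseChange K).toAffine.Point),
      CellC W p → W.conductorNorm ℤ = N →
      IsImaginaryQuadratic K → NumberField.discr K < -4 → SatisfiesHeegnerHypothesis N K →
      (W.quadraticTwist (NumberField.discr K : ℚ)).entireLFunction 1 ≠ 0 →
      WeierstrassCurve.Affine.Point.map ιK.toRatAlgHom P = heegnerPointComplex Dt H →
      ¬ (p : ℤ) ∣ Dt.c → ¬ IsOfFinAddOrder P →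
      Odd (NumberField.discr K) →
      ∀ (κ : ZpExtension K p), κ.IsAnticyclotomic →
        ∀ (γ : Field.absoluteGaloisGroup K) [Fact (κ.IsTopGenerator γ)]
          (𝔭 : HeightOneSpectrum (𝓞 K)), ((p : ℕ) : 𝓞 K) ∈ 𝔭.asIdeal →
          𝔭.asIdeal.ramificationIdx (𝓞 ℚ) = 1 → 𝔭.asIdeal.inertiaDeg (𝓞 ℚ) = 1 →
          ∀ (𝔭bar : HeightOneSpectrum (𝓞 K)), ((p : ℕ) : 𝓞 K) ∈ 𝔭bar.asIdeal → 𝔭bar ≠ 𝔭 →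
            ((Ideal.span {(p : ℤ)}).primesOver (𝓞 K)).ncard = 2 →
          ∀ (f : CuspForm (CongruenceSubgroup.Gamma0 N) 2), IsNewformOf W f →
            ∀ (ι' : PadicAlgCl p ≃+* ℂ),
              (∀ (w : InfinitePlace K) (k : 𝓞 K),
                k ∈ 𝔭.asIdeal ↔ ‖ι'.symm (w.embedding (k : K))‖ < 1) →
              ∀ (ΩK : ℂ) (Ωp : ℂ_[p]) (Q : PowerSeries 𝓞_ℂ_[p]), ΩK ≠ 0 → ‖Ωp‖ = 1 →
                R1.IsBDPLFunctionInt p ι' 𝔭 κ γ f ΩK Ωp Q →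
      ∀ (L : PowerSeries (PowerSeries (unrIntegers p))) (x : ℕ → ℤ_[p]) (D : ℕ → Skinner2016.HidaCongruentForm W p 1),
        (∀ k, ‖x k‖ < 1) ∧ Filter.Tendsto x Filter.atTop (nhds 0) ∧
        (∃ e : ℕ, PowerSeries.C ((p : 𝓞_ℂ_[p]) ^ e) * Q ∈
          Ideal.span {PowerSeries.map (R1.unrToCpInt p) (PowerSeries.map (PowerSeries.constantCoeff (R := unrIntegers p)) L)}) ∧
        (∀ k : ℕ, (∀ y : coeffField (D k).g, ι' ((D k).ι y) = (y : ℂ)) ∧ 2 * ((p : ℤ) - 1) ∣ (D k).k - 2 ∧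
          ∃ (ΩKg : ℂ) (Ωpg : ℂ_[p]) (Lg : UnrSeries p), ΩKg ≠ 0 ∧ ‖Ωpg‖ = 1 ∧
            IsBDPLFunctionWt ι' 𝔭 κ γ (D k).g ΩKg Ωpg Lg ∧
          ∃ Ψ : UnrSeries p,
            (∃ U : PowerSeries (PowerSeries (unrIntegers p)),
              PowerSeries.map (PowerSeries.C (R := unrIntegers p)) Ψ =
                L + PowerSeries.C (PowerSeries.X - PowerSeries.C (toUnr p (x k))) * U) ∧
            (∃ e : ℕ, PowerSeries.C ((p : 𝓞_ℂ_[p]) ^ e) * PowerSeries.map (R1.unrToCpInt p) Ψ ∈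
              Ideal.span {PowerSeries.map (R1.unrToCpInt p) Lg})) ∧
        (∃ A : ℕ → UnrSeries p, ∀ ℓ : ℕ, ℓ.Prime → ¬ ℓ ∣ N →
          (∃ U : UnrSeries p, A ℓ = PowerSeries.C (toUnr p ((W.frobeniusTrace ℓ : ℤ) : ℤ_[p])) + PowerSeries.X * U) ∧
          ∀ k : ℕ, ∃ (c : unrIntegers p) (U : UnrSeries p),
            A ℓ = PowerSeries.C c + (PowerSeries.X - PowerSeries.C (toUnr p (x k))) * U ∧
            ((c : ℂ_[p]) = algebraMap (PadicAlgCl p) ℂ_[p]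
              ((D k).ι ⟨(UpperHalfPlane.qExpansion 1 ⇑(D k).g).coeff ℓ, coeff_mem_coeffField (D k).g ℓ⟩))) →
      ∃ (_ : TopologicalSpace (PowerSeries ℤ_[p])) (A₂ : Type) (_ : AddCommGroup A₂)
        (_ : Module (PowerSeries ℤ_[p]) A₂) (_ : TopologicalSpace A₂) (_ : DiscreteTopology A₂)
        (ρ₂ : ContinuousRep (Field.absoluteGaloisGroup K) (PowerSeries ℤ_[p]) A₂)
        (_ : TopologicalSpace (PowerSeries (PowerSeries ℤ_[p])))
        (_ : ContinuousSMul (PowerSeries (PowerSeries ℤ_[p])) (BigRepModule (PowerSeries ℤ_[p]) p A₂))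
        (_ : Module (PowerSeries ℤ_[p]) (XBig κ ρ₂ 𝔭bar (∅ : Set (HeightOneSpectrum (𝓞 K)))))
        (_ : IsScalarTower (PowerSeries ℤ_[p]) (PowerSeries (PowerSeries ℤ_[p]))
          (XBig κ ρ₂ 𝔭bar (∅ : Set (HeightOneSpectrum (𝓞 K))))),
        Module.Finite (PowerSeries (PowerSeries ℤ_[p])) (XBig κ ρ₂ 𝔭bar (∅ : Set (HeightOneSpectrum (𝓞 K)))) ∧
        (∃ s : PowerSeries (PowerSeries ℤ_[p]),
          ¬ (PowerSeries.C (PowerSeries.X : PowerSeries ℤ_[p]) ∣ s) ∧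
            ∀ m : XBig κ ρ₂ 𝔭bar (∅ : Set (HeightOneSpectrum (𝓞 K))), s • m = 0) ∧
        (∃ j : ℕ, Ideal.span {PowerSeries.C ((p : ℤ_[p]) ^ j)} *
            (Literature.NumberTheory.EllipticCurves.Module.charIdeal (PowerSeries (PowerSeries ℤ_[p]))
                (XBig κ ρ₂ 𝔭bar (∅ : Set (HeightOneSpectrum (𝓞 K))))).map
              (PowerSeries.map (PowerSeries.constantCoeff (R := ℤ_[p]))) ≤
          XAc.charIdeal (W.baseChange K) p κ 𝔭bar ∅ γ) ∧
        ∀ k : ℕ,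
          (∃ s : PowerSeries (PowerSeries ℤ_[p]),
            ¬ (PowerSeries.C (PowerSeries.X - PowerSeries.C (x k)) ∣ s) ∧
              ∀ m : XBig κ ρ₂ 𝔭bar (∅ : Set (HeightOneSpectrum (𝓞 K))), s • m = 0) ∧
          ∀ (b : padicCoeffIntegers (D k).ι →+* 𝓞_ℂ_[p]),
            (∀ y, ((b y : 𝓞_ℂ_[p]) : ℂ_[p]) =
              algebraMap (PadicAlgCl p) ℂ_[p] (padicCoeffIntegers.toPadicAlgCl (D k).ι y)) →
          ∀ [TopologicalSpace (PowerSeries (padicCoeffIntegers (D k).ι))]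
            [ContinuousSMul (PowerSeries (padicCoeffIntegers (D k).ι))
              (BigRepModule (padicCoeffIntegers (D k).ι) p (Cofree (D k).Δ.selfDualRep (padicCoeffField (D k).ι)))],
            ∃ j : ℕ, Ideal.span {PowerSeries.C ((p : 𝓞_ℂ_[p]) ^ j)} *
                (XBig.charIdeal κ ((D k).Δ.selfDualCofreeRepOver K) 𝔭bar
                  (∅ : Set (HeightOneSpectrum (𝓞 K)))).map (PowerSeries.map b) ≤
              (Literature.NumberTheory.EllipticCurves.Module.charIdeal (PowerSeries ℤ_[p])
                  (QuotSMulTop (PowerSeries.C (PowerSeries.X - PowerSeries.C (x k)))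
                    (XBig κ ρ₂ 𝔭bar (∅ : Set (HeightOneSpectrum (𝓞 K)))))).map
                (PowerSeries.map (R1.toCpInt p))
    )
    (hHer1 : ∀ (A B : Type) [CommRing A] [CommRing B] [IsDomain A] [IsDomain B] [IsNoetherianRing A] [IsNoetherianRing B]
      [Algebra A B], UniqueFactorizationMonoid A → UniqueFactorizationMonoid B →
    ∀ (π : B) (φ : B →+* A),
      (∀ a : A, φ (algebraMap A B a) = a) → φ π = 0 → (∀ b : B, φ b = 0 → π ∣ b) →
    ∀ (N : Type) [AddCommGroup N] [Module B N] [Module A N] [IsScalarTower A B N] [Module.Finite B N],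
      (∃ s : B, ¬ π ∣ s ∧ ∀ m : N, s • m = 0) →
      Literature.NumberTheory.EllipticCurves.Module.charIdeal A (QuotSMulTop π N) ≤
        (Literature.NumberTheory.EllipticCurves.Module.charIdeal B N).map φ) :
    ∀ (W : WeierstrassCurve ℚ) [W.IsElliptic] [W.IsGloballyMinimal] (p : ℕ) [Fact p.Prime],
    ∀ (N : ℕ) [NeZero N] (K : Type) [Field K] [NumberField K] (Dt : ModularParametrizationData W N)
      (H : HeegnerDatum N (NumberField.discr K)) (ιK : K →+* ℂ) (P : (W.baseChange K).toAffine.Point),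
      CellC W p → W.conductorNorm ℤ = N →
      IsImaginaryQuadratic K → NumberField.discr K < -4 → SatisfiesHeegnerHypothesis N K →
      (W.quadraticTwist (NumberField.discr K : ℚ)).entireLFunction 1 ≠ 0 →
      WeierstrassCurve.Affine.Point.map ιK.toRatAlgHom P = heegnerPointComplex Dt H →
      ¬ (p : ℤ) ∣ Dt.c → ¬ IsOfFinAddOrder P →
      Odd (NumberField.discr K) →
      ∀ (κ : ZpExtension K p), κ.IsAnticyclotomic →
        ∀ (γ : Field.absoluteGaloisGroup K) [Fact (κ.IsTopGenerator γ)]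
          (𝔭 : HeightOneSpectrum (𝓞 K)), ((p : ℕ) : 𝓞 K) ∈ 𝔭.asIdeal →
          𝔭.asIdeal.ramificationIdx (𝓞 ℚ) = 1 → 𝔭.asIdeal.inertiaDeg (𝓞 ℚ) = 1 →
          ∀ (𝔭bar : HeightOneSpectrum (𝓞 K)), ((p : ℕ) : 𝓞 K) ∈ 𝔭bar.asIdeal → 𝔭bar ≠ 𝔭 →
            ((Ideal.span {(p : ℤ)}).primesOver (𝓞 K)).ncard = 2 →
          ∀ (f : CuspForm (CongruenceSubgroup.Gamma0 N) 2), IsNewformOf W f →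
            ∀ (ι' : PadicAlgCl p ≃+* ℂ),
              (∀ (w : InfinitePlace K) (k : 𝓞 K),
                k ∈ 𝔭.asIdeal ↔ ‖ι'.symm (w.embedding (k : K))‖ < 1) →
              ∀ (ΩK : ℂ) (Ωp : ℂ_[p]) (Q : PowerSeries 𝓞_ℂ_[p]), ΩK ≠ 0 → ‖Ωp‖ = 1 →
                R1.IsBDPLFunctionInt p ι' 𝔭 κ γ f ΩK Ωp Q →
      ∀ (L : PowerSeries (PowerSeries (unrIntegers p))) (x : ℕ → ℤ_[p]) (D : ℕ → Skinner2016.HidaCongruentForm W p 1),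
        (∀ k, ‖x k‖ < 1) ∧ Filter.Tendsto x Filter.atTop (nhds 0) ∧
        (∃ e : ℕ, PowerSeries.C ((p : 𝓞_ℂ_[p]) ^ e) * Q ∈
          Ideal.span {PowerSeries.map (R1.unrToCpInt p) (PowerSeries.map (PowerSeries.constantCoeff (R := unrIntegers p)) L)}) ∧
        (∀ k : ℕ, (∀ y : coeffField (D k).g, ι' ((D k).ι y) = (y : ℂ)) ∧ 2 * ((p : ℤ) - 1) ∣ (D k).k - 2 ∧
          ∃ (ΩKg : ℂ) (Ωpg : ℂ_[p]) (Lg : UnrSeries p), ΩKg ≠ 0 ∧ ‖Ωpg‖ = 1 ∧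
            IsBDPLFunctionWt ι' 𝔭 κ γ (D k).g ΩKg Ωpg Lg ∧
          ∃ Ψ : UnrSeries p,
            (∃ U : PowerSeries (PowerSeries (unrIntegers p)),
              PowerSeries.map (PowerSeries.C (R := unrIntegers p)) Ψ =
                L + PowerSeries.C (PowerSeries.X - PowerSeries.C (toUnr p (x k))) * U) ∧
            (∃ e : ℕ, PowerSeries.C ((p : 𝓞_ℂ_[p]) ^ e) * PowerSeries.map (R1.unrToCpInt p) Ψ ∈
              Ideal.span {PowerSeries.map (R1.unrToCpInt p) Lg})) ∧
        (∃ A : ℕ → UnrSeries p, ∀ ℓ : ℕ, ℓ.Prime → ¬ ℓ ∣ N →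
          (∃ U : UnrSeries p, A ℓ = PowerSeries.C (toUnr p ((W.frobeniusTrace ℓ : ℤ) : ℤ_[p])) + PowerSeries.X * U) ∧
          ∀ k : ℕ, ∃ (c : unrIntegers p) (U : UnrSeries p),
            A ℓ = PowerSeries.C c + (PowerSeries.X - PowerSeries.C (toUnr p (x k))) * U ∧
            ((c : ℂ_[p]) = algebraMap (PadicAlgCl p) ℂ_[p]
              ((D k).ι ⟨(UpperHalfPlane.qExpansion 1 ⇑(D k).g).coeff ℓ, coeff_mem_coeffField (D k).g ℓ⟩))) →
      ∃ F₀ : PowerSeries (PowerSeries ℤ_[p]),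
        ¬ (PowerSeries.C (PowerSeries.X : PowerSeries ℤ_[p]) ∣ F₀) ∧
        (∃ j : ℕ, PowerSeries.C ((p : 𝓞_ℂ_[p]) ^ j) *
            PowerSeries.map (R1.toCpInt p) (PowerSeries.map (PowerSeries.constantCoeff (R := ℤ_[p])) F₀) ∈
          (XAc.charIdeal (W.baseChange K) p κ 𝔭bar ∅ γ).map (PowerSeries.map (R1.toCpInt p))) ∧
        ∀ k : ℕ, ∃ Φ₀ : PowerSeries ℤ_[p], Φ₀ ≠ 0 ∧
          (∃ U : PowerSeries (PowerSeries ℤ_[p]),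
            PowerSeries.map (PowerSeries.C (R := ℤ_[p])) Φ₀ =
              F₀ + PowerSeries.C (PowerSeries.X - PowerSeries.C (x k)) * U) ∧
          ∀ (b : padicCoeffIntegers (D k).ι →+* 𝓞_ℂ_[p]),
            (∀ y, ((b y : 𝓞_ℂ_[p]) : ℂ_[p]) =
              algebraMap (PadicAlgCl p) ℂ_[p] (padicCoeffIntegers.toPadicAlgCl (D k).ι y)) →
          ∀ [TopologicalSpace (PowerSeries (padicCoeffIntegers (D k).ι))]
            [ContinuousSMul (PowerSeries (padicCoeffIntegers (D k).ι))
              (BigRepModule (padicCoeffIntegers (D k).ι) p (Cofree (D k).Δ.selfDualRep (padicCoeffField (D k).ι)))],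
            ∃ j : ℕ, Ideal.span {PowerSeries.C ((p : 𝓞_ℂ_[p]) ^ j)} *
                (XBig.charIdeal κ ((D k).Δ.selfDualCofreeRepOver K) 𝔭bar
                  (∅ : Set (HeightOneSpectrum (𝓞 K)))).map (PowerSeries.map b) ≤
              Ideal.span {PowerSeries.map (R1.toCpInt p) Φ₀}
 := by
  intro W _ _ p _ N _ K _ _ Dt H ιK P hC hN hK hdisc hHeeg hL1 hP hc hfin hodd κ hκ γ _ 𝔭 h𝔭 hram hdeg 𝔭bar
    h𝔭bar hne hsp f hf ι' hι' ΩK Ωp Q hΩK hΩp hQ L x D hpkg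
  obtain ⟨τ₁, A₂, _iA1, _iA2, _iA3, _iA4, ρ₂, τ₂, _iC, _iM, _iT, hfg, ⟨s₀, hs₀π, hs₀⟩, ⟨j₀, hj₀⟩, hmem⟩ :=
    hM W p N K Dt H ιK P hC hN hK hdisc hHeeg hL1 hP hc hfin hodd κ hκ γ 𝔭 h𝔭 hram hdeg 𝔭bar h𝔭bar hne
      hsp f hf ι' hι' ΩK Ωp Q hΩK hΩp hQ L x D hpkg
  have hxk : ∀ k, ‖x k‖ < 1 := hpkg.1
  haveI hufdB : UniqueFactorizationMonoid (PowerSeries (PowerSeries ℤ_[p])) :=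
    Literature.NumberTheory.IwasawaTheory.uniqueFactorizationMonoid_powerSeries_powerSeries ℤ_[p]
  haveI : Module.Finite (PowerSeries (PowerSeries ℤ_[p]))
      (XBig κ ρ₂ 𝔭bar (∅ : Set (HeightOneSpectrum (𝓞 K)))) := hfg
  -- the retraction `φ₀ = (X ↦ 0)`, kernel `(C X)`
  have hφ₀π : (PowerSeries.map (PowerSeries.constantCoeff (R := ℤ_[p])))
      (PowerSeries.C (PowerSeries.X : PowerSeries ℤ_[p])) = 0 := by
    rw [PowerSeries.map_C, PowerSeries.constantCoeff_X, map_zero]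
  have hφ₀ker : ∀ b : PowerSeries (PowerSeries ℤ_[p]),
      (PowerSeries.map (PowerSeries.constantCoeff (R := ℤ_[p]))) b = 0 →
        PowerSeries.C (PowerSeries.X : PowerSeries ℤ_[p]) ∣ b :=
    fun b hb => C_X_dvd_of_map_constantCoeff_eq_zero b hb
  have hπ₀0 : (PowerSeries.C (PowerSeries.X : PowerSeries ℤ_[p]) : PowerSeries (PowerSeries ℤ_[p])) ≠ 0 := by
    intro h
    have h1 := congrArg (PowerSeries.constantCoeff (R := PowerSeries ℤ_[p])) h
    rw [PowerSeries.constantCoeff_C, map_zero] at h1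
    exact PowerSeries.X_ne_zero h1
  -- `F₀` := a generator of `char_B(X₂)` with `F₀(0,T) ≠ 0`
  obtain ⟨F₀, hF₀, hφF₀⟩ := GenCopy.exists_charIdeal_eq_span_of_retraction (A := PowerSeries ℤ_[p])
    (N := XBig κ ρ₂ 𝔭bar (∅ : Set (HeightOneSpectrum (𝓞 K)))) hφ₀π hφ₀ker hπ₀0 (s := s₀)
    (fun h => hs₀π (hφ₀ker _ h)) hs₀
  -- (nondeg)
  have hX₀ : ¬ (PowerSeries.C (PowerSeries.X : PowerSeries ℤ_[p]) ∣ F₀) := by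
    rintro ⟨G, hG⟩
    apply hφF₀
    rw [hG, map_mul, hφ₀π, zero_mul]
  -- (alg∞): read off (div₀), pushed to `𝓞_{ℂ_p}⟦T⟧`
  have halg : ∃ j : ℕ, PowerSeries.C ((p : 𝓞_ℂ_[p]) ^ j) *
      PowerSeries.map (R1.toCpInt p) (PowerSeries.map (PowerSeries.constantCoeff (R := ℤ_[p])) F₀) ∈
        (XAc.charIdeal (W.baseChange K) p κ 𝔭bar ∅ γ).map (PowerSeries.map (R1.toCpInt p)) := by
    refine ⟨j₀, ?_⟩
    have h1 : PowerSeries.map (PowerSeries.constantCoeff (R := ℤ_[p])) F₀ ∈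
        (Literature.NumberTheory.EllipticCurves.Module.charIdeal (PowerSeries (PowerSeries ℤ_[p]))
            (XBig κ ρ₂ 𝔭bar (∅ : Set (HeightOneSpectrum (𝓞 K))))).map
          (PowerSeries.map (PowerSeries.constantCoeff (R := ℤ_[p]))) := by
      rw [hF₀, Ideal.map_span, Set.image_singleton]
      exact Ideal.mem_span_singleton_self _
    have h2 : PowerSeries.C ((p : ℤ_[p]) ^ j₀) *
        PowerSeries.map (PowerSeries.constantCoeff (R := ℤ_[p])) F₀ ∈
        XAc.charIdeal (W.baseChange K) p κ 𝔭bar ∅ γ :=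
      hj₀ (Ideal.mul_mem_mul (Ideal.mem_span_singleton_self _) h1)
    have h3 := Ideal.mem_map_of_mem (PowerSeries.map (R1.toCpInt p)) h2
    rw [map_mul, PowerSeries.map_C, map_pow, map_natCast] at h3
    exact h3
  refine ⟨F₀, hX₀, halg, fun k => ?_⟩
  -- member `k`: the evaluation retraction `φ_k = (X ↦ x_k)` (LEAD's landed §E, `𝒪 = ℤ_p`)
  obtain ⟨⟨s, hsπ, hs⟩, hctrl⟩ := hmem k
  have ha : x k ∈ IsLocalRing.maximalIdeal ℤ_[p] := by
    rw [PadicInt.maximalIdeal_eq_span_p, Ideal.mem_span_singleton]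
    exact (PadicInt.norm_lt_one_iff_dvd (x k)).mp (hxk k)
  let φ : PowerSeries (PowerSeries ℤ_[p]) →+* PowerSeries ℤ_[p] :=
    PowerSeries.map (AccumHelpers.evAt (x k) ha).toRingHom
  have hφC : ∀ g : PowerSeries ℤ_[p],
      φ (algebraMap (PowerSeries ℤ_[p]) (PowerSeries (PowerSeries ℤ_[p])) g) = g :=
    fun g => TelescopeCarrierAlgOfWitness.evAtMap_map_C _ ha g
  have hφC' : ∀ g : PowerSeries ℤ_[p], φ (PowerSeries.map (PowerSeries.C (R := ℤ_[p])) g) = g :=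
    fun g => TelescopeCarrierAlgOfWitness.evAtMap_map_C _ ha g
  have hφπ : φ (PowerSeries.C (PowerSeries.X - PowerSeries.C (x k))) = 0 :=
    TelescopeCarrierAlgOfWitness.evAtMap_pi _ ha
  have hφker : ∀ b : PowerSeries (PowerSeries ℤ_[p]), φ b = 0 →
      PowerSeries.C (PowerSeries.X - PowerSeries.C (x k)) ∣ b :=
    fun b hb => TelescopeCarrierAlgOfWitness.C_dvd_of_evAtMap_eq_zero _ ha b hb
  have hπ0 : (PowerSeries.C (PowerSeries.X - PowerSeries.C (x k)) : PowerSeries (PowerSeries ℤ_[p])) ≠ 0 := by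
    intro h
    have h1 := congrArg (PowerSeries.constantCoeff (R := PowerSeries ℤ_[p])) h
    rw [PowerSeries.constantCoeff_C, map_zero, sub_eq_zero] at h1
    have h2 := congrArg (PowerSeries.coeff 1) h1
    rw [PowerSeries.coeff_one_X, PowerSeries.coeff_C, if_neg one_ne_zero] at h2
    exact one_ne_zero h2
  -- `Φ₀ := F₀(x_k,T) ≠ 0`
  obtain ⟨Fk, hFk, hφFk⟩ := GenCopy.exists_charIdeal_eq_span_of_retraction (A := PowerSeries ℤ_[p])
    (N := XBig κ ρ₂ 𝔭bar (∅ : Set (HeightOneSpectrum (𝓞 K)))) hφπ hφker hπ0 (s := s)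
    (fun h => hsπ (hφker _ h)) hs
  have hΦ0 : φ F₀ ≠ 0 := by
    intro h0
    apply hφFk
    have hass : Associated F₀ Fk := by
      rw [← Ideal.span_singleton_eq_span_singleton, ← hF₀, ← hFk]
    obtain ⟨u, hu⟩ := hass
    rw [← hu, map_mul, h0, zero_mul]
  refine ⟨φ F₀, hΦ0, ?_, ?_⟩
  · -- remainder form
    have hdvd : PowerSeries.C (PowerSeries.X - PowerSeries.C (x k)) ∣
        PowerSeries.map (PowerSeries.C (R := ℤ_[p])) (φ F₀) - F₀ := by
      refine hφker _ ?_
      rw [map_sub, hφC', sub_self]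
    obtain ⟨U, hU⟩ := hdvd
    exact ⟨U, by rw [← hU, add_sub_cancel]⟩
  · -- one-sided Herbrand at `X ↦ x_k` under (ctrl_k), read in `𝓞_{ℂ_p}⟦T⟧`
    intro b hb _ _
    obtain ⟨j, hj⟩ := hctrl b hb
    refine ⟨j, hj.trans ?_⟩
    have hle := hHer1 (PowerSeries ℤ_[p]) (PowerSeries (PowerSeries ℤ_[p])) inferInstance hufdB _ φ hφC hφπ hφker
      (XBig κ ρ₂ 𝔭bar (∅ : Set (HeightOneSpectrum (𝓞 K)))) ⟨s, hsπ, hs⟩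
    refine (Ideal.map_mono hle).trans ?_
    rw [hF₀, Ideal.map_span, Set.image_singleton, Ideal.map_span, Set.image_singleton]

/-! ## §K2 (v1.1) K2-M ⟹ K2-M♭: (ctrl₀) + (pure) ⟹ (div₀) through the two-sided Herbrand formula at `X ↦ 0` -/

set_option maxHeartbeats 1600000 in
/-- **K2-M♭ from K2-M** (the only place purity is used): `p^{j+m}·F₀(0,T) ∈ Ch_Λ(X_ac)` from
`char_Λ(X₂/XX₂) = char_Λ(X₂[X])·(F₀(0,T))` (`hHer2`, x2-p2 #2 p729686 by name once built), `(p^m) ⊆ char_Λ(X₂[X])` (pure) and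
`p^j·char_Λ(X₂/XX₂) ⊆ Ch_Λ(X_ac)` (ctrl₀); all other conjuncts carried over. Sorry-free. -/
theorem moduleDiv_of_module
    (hM :
    ∀ (W : WeierstrassCurve ℚ) [W.IsElliptic] [W.IsGloballyMinimal] (p : ℕ) [Fact p.Prime],
    ∀ (N : ℕ) [NeZero N] (K : Type) [Field K] [NumberField K] (Dt : ModularParametrizationData W N)
      (H : HeegnerDatum N (NumberField.discr K)) (ιK : K →+* ℂ) (P : (W.baseChange K).toAffine.Point),
      CellC W p → W.conductorNorm ℤ = N →
      IsImaginaryQuadratic K → NumberField.discr K < -4 → SatisfiesHeegnerHypothesis N K →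
      (W.quadraticTwist (NumberField.discr K : ℚ)).entireLFunction 1 ≠ 0 →
      WeierstrassCurve.Affine.Point.map ιK.toRatAlgHom P = heegnerPointComplex Dt H →
      ¬ (p : ℤ) ∣ Dt.c → ¬ IsOfFinAddOrder P →
      Odd (NumberField.discr K) →
      ∀ (κ : ZpExtension K p), κ.IsAnticyclotomic →
        ∀ (γ : Field.absoluteGaloisGroup K) [Fact (κ.IsTopGenerator γ)]
          (𝔭 : HeightOneSpectrum (𝓞 K)), ((p : ℕ) : 𝓞 K) ∈ 𝔭.asIdeal →
          𝔭.asIdeal.ramificationIdx (𝓞 ℚ) = 1 → 𝔭.asIdeal.inertiaDeg (𝓞 ℚ) = 1 →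
          ∀ (𝔭bar : HeightOneSpectrum (𝓞 K)), ((p : ℕ) : 𝓞 K) ∈ 𝔭bar.asIdeal → 𝔭bar ≠ 𝔭 →
            ((Ideal.span {(p : ℤ)}).primesOver (𝓞 K)).ncard = 2 →
          ∀ (f : CuspForm (CongruenceSubgroup.Gamma0 N) 2), IsNewformOf W f →
            ∀ (ι' : PadicAlgCl p ≃+* ℂ),
              (∀ (w : InfinitePlace K) (k : 𝓞 K),
                k ∈ 𝔭.asIdeal ↔ ‖ι'.symm (w.embedding (k : K))‖ < 1) →
              ∀ (ΩK : ℂ) (Ωp : ℂ_[p]) (Q : PowerSeries 𝓞_ℂ_[p]), ΩK ≠ 0 → ‖Ωp‖ = 1 →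
                R1.IsBDPLFunctionInt p ι' 𝔭 κ γ f ΩK Ωp Q →
      ∀ (L : PowerSeries (PowerSeries (unrIntegers p))) (x : ℕ → ℤ_[p]) (D : ℕ → Skinner2016.HidaCongruentForm W p 1),
        (∀ k, ‖x k‖ < 1) ∧ Filter.Tendsto x Filter.atTop (nhds 0) ∧
        (∃ e : ℕ, PowerSeries.C ((p : 𝓞_ℂ_[p]) ^ e) * Q ∈
          Ideal.span {PowerSeries.map (R1.unrToCpInt p) (PowerSeries.map (PowerSeries.constantCoeff (R := unrIntegers p)) L)}) ∧
        (∀ k : ℕ, (∀ y : coeffField (D k).g, ι' ((D k).ι y) = (y : ℂ)) ∧ 2 * ((p : ℤ) - 1) ∣ (D k).k - 2 ∧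
          ∃ (ΩKg : ℂ) (Ωpg : ℂ_[p]) (Lg : UnrSeries p), ΩKg ≠ 0 ∧ ‖Ωpg‖ = 1 ∧
            IsBDPLFunctionWt ι' 𝔭 κ γ (D k).g ΩKg Ωpg Lg ∧
          ∃ Ψ : UnrSeries p,
            (∃ U : PowerSeries (PowerSeries (unrIntegers p)),
              PowerSeries.map (PowerSeries.C (R := unrIntegers p)) Ψ =
                L + PowerSeries.C (PowerSeries.X - PowerSeries.C (toUnr p (x k))) * U) ∧
            (∃ e : ℕ, PowerSeries.C ((p : 𝓞_ℂ_[p]) ^ e) * PowerSeries.map (R1.unrToCpInt p) Ψ ∈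
              Ideal.span {PowerSeries.map (R1.unrToCpInt p) Lg})) ∧
        (∃ A : ℕ → UnrSeries p, ∀ ℓ : ℕ, ℓ.Prime → ¬ ℓ ∣ N →
          (∃ U : UnrSeries p, A ℓ = PowerSeries.C (toUnr p ((W.frobeniusTrace ℓ : ℤ) : ℤ_[p])) + PowerSeries.X * U) ∧
          ∀ k : ℕ, ∃ (c : unrIntegers p) (U : UnrSeries p),
            A ℓ = PowerSeries.C c + (PowerSeries.X - PowerSeries.C (toUnr p (x k))) * U ∧
            ((c : ℂ_[p]) = algebraMap (PadicAlgCl p) ℂ_[p]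
              ((D k).ι ⟨(UpperHalfPlane.qExpansion 1 ⇑(D k).g).coeff ℓ, coeff_mem_coeffField (D k).g ℓ⟩))) →
      ∃ (_ : TopologicalSpace (PowerSeries ℤ_[p])) (A₂ : Type) (_ : AddCommGroup A₂)
        (_ : Module (PowerSeries ℤ_[p]) A₂) (_ : TopologicalSpace A₂) (_ : DiscreteTopology A₂)
        (ρ₂ : ContinuousRep (Field.absoluteGaloisGroup K) (PowerSeries ℤ_[p]) A₂)
        (_ : TopologicalSpace (PowerSeries (PowerSeries ℤ_[p])))
        (_ : ContinuousSMul (PowerSeries (PowerSeries ℤ_[p])) (BigRepModule (PowerSeries ℤ_[p]) p A₂))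
        (_ : Module (PowerSeries ℤ_[p]) (XBig κ ρ₂ 𝔭bar (∅ : Set (HeightOneSpectrum (𝓞 K)))))
        (_ : IsScalarTower (PowerSeries ℤ_[p]) (PowerSeries (PowerSeries ℤ_[p]))
          (XBig κ ρ₂ 𝔭bar (∅ : Set (HeightOneSpectrum (𝓞 K))))),
        Module.Finite (PowerSeries (PowerSeries ℤ_[p])) (XBig κ ρ₂ 𝔭bar (∅ : Set (HeightOneSpectrum (𝓞 K)))) ∧
        (∃ s : PowerSeries (PowerSeries ℤ_[p]),
          ¬ (PowerSeries.C (PowerSeries.X : PowerSeries ℤ_[p]) ∣ s) ∧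
            ∀ m : XBig κ ρ₂ 𝔭bar (∅ : Set (HeightOneSpectrum (𝓞 K))), s • m = 0) ∧
        (∃ j : ℕ, Ideal.span {PowerSeries.C ((p : ℤ_[p]) ^ j)} *
            Literature.NumberTheory.EllipticCurves.Module.charIdeal (PowerSeries ℤ_[p])
              (QuotSMulTop (PowerSeries.C (PowerSeries.X : PowerSeries ℤ_[p]))
                (XBig κ ρ₂ 𝔭bar (∅ : Set (HeightOneSpectrum (𝓞 K))))) ≤
          XAc.charIdeal (W.baseChange K) p κ 𝔭bar ∅ γ) ∧
        (∃ m : ℕ, Ideal.span {PowerSeries.C ((p : ℤ_[p]) ^ m)} ≤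
          Literature.NumberTheory.EllipticCurves.Module.charIdeal (PowerSeries ℤ_[p])
            (Submodule.torsionBy (PowerSeries (PowerSeries ℤ_[p]))
              (XBig κ ρ₂ 𝔭bar (∅ : Set (HeightOneSpectrum (𝓞 K))))
              (PowerSeries.C (PowerSeries.X : PowerSeries ℤ_[p])))) ∧
        ∀ k : ℕ,
          (∃ s : PowerSeries (PowerSeries ℤ_[p]),
            ¬ (PowerSeries.C (PowerSeries.X - PowerSeries.C (x k)) ∣ s) ∧
              ∀ m : XBig κ ρ₂ 𝔭bar (∅ : Set (HeightOneSpectrum (𝓞 K))), s • m = 0) ∧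
          ∀ (b : padicCoeffIntegers (D k).ι →+* 𝓞_ℂ_[p]),
            (∀ y, ((b y : 𝓞_ℂ_[p]) : ℂ_[p]) =
              algebraMap (PadicAlgCl p) ℂ_[p] (padicCoeffIntegers.toPadicAlgCl (D k).ι y)) →
          ∀ [TopologicalSpace (PowerSeries (padicCoeffIntegers (D k).ι))]
            [ContinuousSMul (PowerSeries (padicCoeffIntegers (D k).ι))
              (BigRepModule (padicCoeffIntegers (D k).ι) p (Cofree (D k).Δ.selfDualRep (padicCoeffField (D k).ι)))],
            ∃ j : ℕ, Ideal.span {PowerSeries.C ((p : 𝓞_ℂ_[p]) ^ j)} *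
                (XBig.charIdeal κ ((D k).Δ.selfDualCofreeRepOver K) 𝔭bar
                  (∅ : Set (HeightOneSpectrum (𝓞 K)))).map (PowerSeries.map b) ≤
              (Literature.NumberTheory.EllipticCurves.Module.charIdeal (PowerSeries ℤ_[p])
                  (QuotSMulTop (PowerSeries.C (PowerSeries.X - PowerSeries.C (x k)))
                    (XBig κ ρ₂ 𝔭bar (∅ : Set (HeightOneSpectrum (𝓞 K)))))).map
                (PowerSeries.map (R1.toCpInt p))
    )
    (hHer2 : ∀ (A B : Type) [CommRing A] [CommRing B] [Algebra A B] [IsDomain A] [IsNoetherianRing A]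
      [UniqueFactorizationMonoid A] [IsDomain B] [IsNoetherianRing B] [UniqueFactorizationMonoid B]
      (π : B) (φ : B →+* A), (∀ a : A, φ (algebraMap A B a) = a) → φ π = 0 → (∀ b : B, φ b = 0 → π ∣ b) → π ≠ 0 →
      ∀ (N : Type) [AddCommGroup N] [Module B N] [Module.Finite B N] [Module A N] [IsScalarTower A B N],
        (∃ s : B, φ s ≠ 0 ∧ ∀ m : N, s • m = 0) →
        Literature.NumberTheory.EllipticCurves.Module.charIdeal A (QuotSMulTop π N) =
          Literature.NumberTheory.EllipticCurves.Module.charIdeal A (Submodule.torsionBy B N π) *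
            (Literature.NumberTheory.EllipticCurves.Module.charIdeal B N).map φ) :
    ∀ (W : WeierstrassCurve ℚ) [W.IsElliptic] [W.IsGloballyMinimal] (p : ℕ) [Fact p.Prime],
    ∀ (N : ℕ) [NeZero N] (K : Type) [Field K] [NumberField K] (Dt : ModularParametrizationData W N)
      (H : HeegnerDatum N (NumberField.discr K)) (ιK : K →+* ℂ) (P : (W.baseChange K).toAffine.Point),
      CellC W p → W.conductorNorm ℤ = N →
      IsImaginaryQuadratic K → NumberField.discr K < -4 → SatisfiesHeegnerHypothesis N K →
      (W.quadraticTwist (NumberField.discr K : ℚ)).entireLFunction 1 ≠ 0 →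
      WeierstrassCurve.Affine.Point.map ιK.toRatAlgHom P = heegnerPointComplex Dt H →
      ¬ (p : ℤ) ∣ Dt.c → ¬ IsOfFinAddOrder P →
      Odd (NumberField.discr K) →
      ∀ (κ : ZpExtension K p), κ.IsAnticyclotomic →
        ∀ (γ : Field.absoluteGaloisGroup K) [Fact (κ.IsTopGenerator γ)]
          (𝔭 : HeightOneSpectrum (𝓞 K)), ((p : ℕ) : 𝓞 K) ∈ 𝔭.asIdeal →
          𝔭.asIdeal.ramificationIdx (𝓞 ℚ) = 1 → 𝔭.asIdeal.inertiaDeg (𝓞 ℚ) = 1 →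
          ∀ (𝔭bar : HeightOneSpectrum (𝓞 K)), ((p : ℕ) : 𝓞 K) ∈ 𝔭bar.asIdeal → 𝔭bar ≠ 𝔭 →
            ((Ideal.span {(p : ℤ)}).primesOver (𝓞 K)).ncard = 2 →
          ∀ (f : CuspForm (CongruenceSubgroup.Gamma0 N) 2), IsNewformOf W f →
            ∀ (ι' : PadicAlgCl p ≃+* ℂ),
              (∀ (w : InfinitePlace K) (k : 𝓞 K),
                k ∈ 𝔭.asIdeal ↔ ‖ι'.symm (w.embedding (k : K))‖ < 1) →
              ∀ (ΩK : ℂ) (Ωp : ℂ_[p]) (Q : PowerSeries 𝓞_ℂ_[p]), ΩK ≠ 0 → ‖Ωp‖ = 1 →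
                R1.IsBDPLFunctionInt p ι' 𝔭 κ γ f ΩK Ωp Q →
      ∀ (L : PowerSeries (PowerSeries (unrIntegers p))) (x : ℕ → ℤ_[p]) (D : ℕ → Skinner2016.HidaCongruentForm W p 1),
        (∀ k, ‖x k‖ < 1) ∧ Filter.Tendsto x Filter.atTop (nhds 0) ∧
        (∃ e : ℕ, PowerSeries.C ((p : 𝓞_ℂ_[p]) ^ e) * Q ∈
          Ideal.span {PowerSeries.map (R1.unrToCpInt p) (PowerSeries.map (PowerSeries.constantCoeff (R := unrIntegers p)) L)}) ∧
        (∀ k : ℕ, (∀ y : coeffField (D k).g, ι' ((D k).ι y) = (y : ℂ)) ∧ 2 * ((p : ℤ) - 1) ∣ (D k).k - 2 ∧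
          ∃ (ΩKg : ℂ) (Ωpg : ℂ_[p]) (Lg : UnrSeries p), ΩKg ≠ 0 ∧ ‖Ωpg‖ = 1 ∧
            IsBDPLFunctionWt ι' 𝔭 κ γ (D k).g ΩKg Ωpg Lg ∧
          ∃ Ψ : UnrSeries p,
            (∃ U : PowerSeries (PowerSeries (unrIntegers p)),
              PowerSeries.map (PowerSeries.C (R := unrIntegers p)) Ψ =
                L + PowerSeries.C (PowerSeries.X - PowerSeries.C (toUnr p (x k))) * U) ∧
            (∃ e : ℕ, PowerSeries.C ((p : 𝓞_ℂ_[p]) ^ e) * PowerSeries.map (R1.unrToCpInt p) Ψ ∈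
              Ideal.span {PowerSeries.map (R1.unrToCpInt p) Lg})) ∧
        (∃ A : ℕ → UnrSeries p, ∀ ℓ : ℕ, ℓ.Prime → ¬ ℓ ∣ N →
          (∃ U : UnrSeries p, A ℓ = PowerSeries.C (toUnr p ((W.frobeniusTrace ℓ : ℤ) : ℤ_[p])) + PowerSeries.X * U) ∧
          ∀ k : ℕ, ∃ (c : unrIntegers p) (U : UnrSeries p),
            A ℓ = PowerSeries.C c + (PowerSeries.X - PowerSeries.C (toUnr p (x k))) * U ∧
            ((c : ℂ_[p]) = algebraMap (PadicAlgCl p) ℂ_[p]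
              ((D k).ι ⟨(UpperHalfPlane.qExpansion 1 ⇑(D k).g).coeff ℓ, coeff_mem_coeffField (D k).g ℓ⟩))) →
      ∃ (_ : TopologicalSpace (PowerSeries ℤ_[p])) (A₂ : Type) (_ : AddCommGroup A₂)
        (_ : Module (PowerSeries ℤ_[p]) A₂) (_ : TopologicalSpace A₂) (_ : DiscreteTopology A₂)
        (ρ₂ : ContinuousRep (Field.absoluteGaloisGroup K) (PowerSeries ℤ_[p]) A₂)
        (_ : TopologicalSpace (PowerSeries (PowerSeries ℤ_[p])))
        (_ : ContinuousSMul (PowerSeries (PowerSeries ℤ_[p])) (BigRepModule (PowerSeries ℤ_[p]) p A₂))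
        (_ : Module (PowerSeries ℤ_[p]) (XBig κ ρ₂ 𝔭bar (∅ : Set (HeightOneSpectrum (𝓞 K)))))
        (_ : IsScalarTower (PowerSeries ℤ_[p]) (PowerSeries (PowerSeries ℤ_[p]))
          (XBig κ ρ₂ 𝔭bar (∅ : Set (HeightOneSpectrum (𝓞 K))))),
        Module.Finite (PowerSeries (PowerSeries ℤ_[p])) (XBig κ ρ₂ 𝔭bar (∅ : Set (HeightOneSpectrum (𝓞 K)))) ∧
        (∃ s : PowerSeries (PowerSeries ℤ_[p]),
          ¬ (PowerSeries.C (PowerSeries.X : PowerSeries ℤ_[p]) ∣ s) ∧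
            ∀ m : XBig κ ρ₂ 𝔭bar (∅ : Set (HeightOneSpectrum (𝓞 K))), s • m = 0) ∧
        (∃ j : ℕ, Ideal.span {PowerSeries.C ((p : ℤ_[p]) ^ j)} *
            (Literature.NumberTheory.EllipticCurves.Module.charIdeal (PowerSeries (PowerSeries ℤ_[p]))
                (XBig κ ρ₂ 𝔭bar (∅ : Set (HeightOneSpectrum (𝓞 K))))).map
              (PowerSeries.map (PowerSeries.constantCoeff (R := ℤ_[p]))) ≤
          XAc.charIdeal (W.baseChange K) p κ 𝔭bar ∅ γ) ∧
        ∀ k : ℕ,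
          (∃ s : PowerSeries (PowerSeries ℤ_[p]),
            ¬ (PowerSeries.C (PowerSeries.X - PowerSeries.C (x k)) ∣ s) ∧
              ∀ m : XBig κ ρ₂ 𝔭bar (∅ : Set (HeightOneSpectrum (𝓞 K))), s • m = 0) ∧
          ∀ (b : padicCoeffIntegers (D k).ι →+* 𝓞_ℂ_[p]),
            (∀ y, ((b y : 𝓞_ℂ_[p]) : ℂ_[p]) =
              algebraMap (PadicAlgCl p) ℂ_[p] (padicCoeffIntegers.toPadicAlgCl (D k).ι y)) →
          ∀ [TopologicalSpace (PowerSeries (padicCoeffIntegers (D k).ι))]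
            [ContinuousSMul (PowerSeries (padicCoeffIntegers (D k).ι))
              (BigRepModule (padicCoeffIntegers (D k).ι) p (Cofree (D k).Δ.selfDualRep (padicCoeffField (D k).ι)))],
            ∃ j : ℕ, Ideal.span {PowerSeries.C ((p : 𝓞_ℂ_[p]) ^ j)} *
                (XBig.charIdeal κ ((D k).Δ.selfDualCofreeRepOver K) 𝔭bar
                  (∅ : Set (HeightOneSpectrum (𝓞 K)))).map (PowerSeries.map b) ≤
              (Literature.NumberTheory.EllipticCurves.Module.charIdeal (PowerSeries ℤ_[p])
                  (QuotSMulTop (PowerSeries.C (PowerSeries.X - PowerSeries.C (x k)))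
                    (XBig κ ρ₂ 𝔭bar (∅ : Set (HeightOneSpectrum (𝓞 K)))))).map
                (PowerSeries.map (R1.toCpInt p))
 := by
  intro W _ _ p _ N _ K _ _ Dt H ιK P hC hN hK hdisc hHeeg hL1 hP hc hfin hodd κ hκ γ _ 𝔭 h𝔭 hram hdeg 𝔭bar
    h𝔭bar hne hsp f hf ι' hι' ΩK Ωp Q hΩK hΩp hQ L x D hpkg
  obtain ⟨τ₁, A₂, _iA1, _iA2, _iA3, _iA4, ρ₂, τ₂, _iC, _iM, _iT, hfg, ⟨s₀, hs₀π, hs₀⟩, ⟨j₀, hj₀⟩, ⟨m₀, hm₀⟩,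
      hmem⟩ :=
    hM W p N K Dt H ιK P hC hN hK hdisc hHeeg hL1 hP hc hfin hodd κ hκ γ 𝔭 h𝔭 hram hdeg 𝔭bar h𝔭bar hne
      hsp f hf ι' hι' ΩK Ωp Q hΩK hΩp hQ L x D hpkg
  haveI : UniqueFactorizationMonoid (PowerSeries (PowerSeries ℤ_[p])) :=
    Literature.NumberTheory.IwasawaTheory.uniqueFactorizationMonoid_powerSeries_powerSeries ℤ_[p]
  haveI : Module.Finite (PowerSeries (PowerSeries ℤ_[p]))
      (XBig κ ρ₂ 𝔭bar (∅ : Set (HeightOneSpectrum (𝓞 K)))) := hfg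
  have hφ₀C : ∀ g : PowerSeries ℤ_[p],
      (PowerSeries.map (PowerSeries.constantCoeff (R := ℤ_[p])))
        (algebraMap (PowerSeries ℤ_[p]) (PowerSeries (PowerSeries ℤ_[p])) g) = g :=
    fun g => map_constantCoeff_map_C g
  have hφ₀π : (PowerSeries.map (PowerSeries.constantCoeff (R := ℤ_[p])))
      (PowerSeries.C (PowerSeries.X : PowerSeries ℤ_[p])) = 0 := by
    rw [PowerSeries.map_C, PowerSeries.constantCoeff_X, map_zero]
  have hφ₀ker : ∀ b : PowerSeries (PowerSeries ℤ_[p]),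
      (PowerSeries.map (PowerSeries.constantCoeff (R := ℤ_[p]))) b = 0 →
        PowerSeries.C (PowerSeries.X : PowerSeries ℤ_[p]) ∣ b :=
    fun b hb => C_X_dvd_of_map_constantCoeff_eq_zero b hb
  have hπ₀0 : (PowerSeries.C (PowerSeries.X : PowerSeries ℤ_[p]) : PowerSeries (PowerSeries ℤ_[p])) ≠ 0 := by
    intro h
    have h1 := congrArg (PowerSeries.constantCoeff (R := PowerSeries ℤ_[p])) h
    rw [PowerSeries.constantCoeff_C, map_zero] at h1
    exact PowerSeries.X_ne_zero h1
  obtain ⟨F₀, hF₀, hφF₀⟩ := GenCopy.exists_charIdeal_eq_span_of_retraction (A := PowerSeries ℤ_[p])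
    (N := XBig κ ρ₂ 𝔭bar (∅ : Set (HeightOneSpectrum (𝓞 K)))) hφ₀π hφ₀ker hπ₀0 (s := s₀)
    (fun h => hs₀π (hφ₀ker _ h)) hs₀
  have hH₀ := hHer2 (PowerSeries ℤ_[p]) (PowerSeries (PowerSeries ℤ_[p])) _ _ hφ₀C hφ₀π hφ₀ker hπ₀0
    (XBig κ ρ₂ 𝔭bar (∅ : Set (HeightOneSpectrum (𝓞 K)))) ⟨s₀, fun h => hs₀π (hφ₀ker _ h), hs₀⟩
  refine ⟨τ₁, A₂, _iA1, _iA2, _iA3, _iA4, ρ₂, τ₂, _iC, _iM, _iT, hfg, ⟨s₀, hs₀π, hs₀⟩, ⟨j₀ + m₀, ?_⟩, hmem⟩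
  rw [hF₀, Ideal.map_span, Set.image_singleton, Ideal.span_singleton_mul_span_singleton,
    Ideal.span_singleton_le_iff_mem]
  have h1 : PowerSeries.C ((p : ℤ_[p]) ^ m₀) *
      PowerSeries.map (PowerSeries.constantCoeff (R := ℤ_[p])) F₀ ∈
      Literature.NumberTheory.EllipticCurves.Module.charIdeal (PowerSeries ℤ_[p])
        (QuotSMulTop (PowerSeries.C (PowerSeries.X : PowerSeries ℤ_[p]))
          (XBig κ ρ₂ 𝔭bar (∅ : Set (HeightOneSpectrum (𝓞 K))))) := by
    rw [hH₀, hF₀, Ideal.map_span, Set.image_singleton]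
    exact Ideal.mul_mem_mul (hm₀ (Ideal.mem_span_singleton_self _)) (Ideal.mem_span_singleton_self _)
  have h2 : PowerSeries.C ((p : ℤ_[p]) ^ j₀) * (PowerSeries.C ((p : ℤ_[p]) ^ m₀) *
      PowerSeries.map (PowerSeries.constantCoeff (R := ℤ_[p])) F₀) ∈
      XAc.charIdeal (W.baseChange K) p κ 𝔭bar ∅ γ :=
    hj₀ (Ideal.mul_mem_mul (Ideal.mem_span_singleton_self _) h1)
  rw [← mul_assoc, ← map_mul, ← pow_add] at h2
  exact h2

end Summit.BirchSwinnertonDyer.BirchSwinnertonDyer.Cruxes.BSDpOnCellC.Telescope.K2Mod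

end
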